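import Literature.Geometry.Lorentzian.KerrHorizonRegularWaveBoundednessProofs
import Literature.Geometry.Lorentzian.KerrSchildGraphDivergence
import Literature.Geometry.Lorentzian.KerrStationaryBlackHole
import HarnessLib

/-!
# The reduction of horizon-regular energy boundedness to a single admissible foliation
# (towards `DafermosRodnianskiShlapentokhRothman2016_energyBoundedness_horizonRegular`, II)

(family `gr`; namespace `Literature.Geometry.Lorentzian`, auxiliary material in
`Literature.Geometry.Lorentzian.Kerr` and `Literature.Geometry.Lorentzian.KerrSchild.Background`)

`KerrHorizonRegularWaveBoundedness.lean` vendors estimate (23) of Theorem 3.1 of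
Dafermos–Rodnianski–Shlapentokh-Rothman (arXiv:1402.7034 = Ann. of Math. 183 (2016)) in its §3.3
form — uniform boundedness of the non-degenerate energy through the translates
`Σ̃_τ = φ_τ(Σ̃₀) = {t* = τ + F}` of an ARBITRARY admissible graph `Σ̃₀ = {t* = F}`
(`Kerr.IsAdmissibleHeight`), for solutions regular across `𝓗⁺` — as the named fact
`DafermosRodnianskiShlapentokhRothman2016_energyBoundedness_horizonRegular`. In the paper this §3.3
form is obtained from Theorem 3.1 (stated for one fixed foliation `Σ_τ = φ_τ(Σ₀)`) "by a reduction
proven as Proposition 4.6.1 of [dr7]" (Dafermos–Rodnianski arXiv:1010.5132, §4.6): local energy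
estimates between two admissible hypersurfaces, the domain of dependence property, and the
time-translation invariance of the problem. `KerrHorizonRegularWaveBoundednessProofs.lean` proved
the finite-in-time half of this (Grönwall through the translates of ONE graph). This file proves
the reduction itself, for the Kerr–Schild-admissible graphs of `Kerr.IsAdmissibleHeight`:

* `KerrSchild.Background.twoGraphWeightedEnergy_le` — Grönwall for the weighted energy along the
  linear interpolation `F_θ = F₁ + θ(F₂ − F₁)` of two uniformly spacelike graphs `F₁ ≤ F₂`
  (divergence identity `E4.graphFlux_sub_eq_integral_divergence` of `KerrSchildGraphDivergence.lean`,
  substitution `u = θ' θ₁`, rate `C · sup (F₂ − F₁)`);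
* `Kerr.exterior_twoGraphCoordEnergy_le`, `kerr_horizonRegular_graphSliceEnergy_le_of_graph_le` —
  **the local energy estimate between two uniformly spacelike graphs on the Kerr exterior, up to
  `𝓗⁺`**: for `F₁ ≤ F₂ ≤ F₁ + L` of slope `≤ 1 − c`,
  `E[τ + F₂] ≤ (144 (1 + 4M/r₊)²/c) e^{(192 (1 + 4M/r₊) D/c) L} E[τ + F₁]`;
* `KerrSchild.Background.fderiv_eq_zero_of_twoGraphWeight`, `Kerr.holeFn`, `Kerr.holeFactor_flux`,
  `Kerr.farWeight`, `Kerr.vanish_of_graphData_far`, `kerr_horizonRegular_vanish_of_graphData` —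
  **the domain of dependence property between two graphs in the far region** (Hawking–Ellis's
  conservation theorem with the weight `graphWeight · χ(⟨x⃗⟩ − ρ₁ − t*)`, an expanding hole whose
  boundary moves faster than light): data vanishing on `{t* = τ + F₁, ‖y‖ > ρ}` vanish on
  `{t* = τ + F₂, ‖y‖ > ρ'}`;
* `Kerr.IsAdmissibleHeight.exists_abs_sub_le` — two admissible heights differ by a bounded
  function (both are `2M log ‖y‖ + const + o(1)`);
* `Kerr.timeTranslate`, `Kerr.contMDiff_timeTranslate`, `Kerr.dalembertian_timeTranslate`,
  `Kerr.mfderiv_timeTranslate_eq_zero`, `Kerr.graphSliceEnergy_timeTranslate` — `ψ ↦ ψ ∘ φ_s`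
  preserves the horizon-regular class of solutions (`∂_{t*}` is Killing) and shifts the graph
  energies;
* `DafermosRodnianskiShlapentokhRothman2016_energyBoundedness_horizonRegular_of_exists` — **if, for
  every subextremal `(M, a)` and `r₋ < r₀ < r₊`, estimate (23) holds uniformly in `τ ≥ 0` through
  the foliation of ONE admissible height `F₀` (horizon-regular class, data compactly supported on
  `{t* = F₀}`), then the named fact holds** (every admissible `F`, with an `F`-dependent constant):
  for `|F − F₀| ≤ L` and `τ ≥ 2L`,
  `E_F(τ) ≤ C E_{F₀}(τ − L) = C E_{F₀}[ψ_L](τ − 2L) ≤ C C₀ E_{F₀}[ψ_L](0) = C C₀ E_{F₀}(L) ≤ C² C₀ E_F(0)`,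
  and `kerr_horizonRegular_graphSliceEnergy_finiteTime` covers `0 ≤ τ ≤ 2L`.

So the unproved content of the named fact is exactly Theorem 3.1 (23) of the Annals paper for a
single admissible foliation (§§4–13 of arXiv:1402.7034 with arXiv:1010.5132); nothing is assumed
here — every statement in this file is proved.

## References

* M. Dafermos, I. Rodnianski, Y. Shlapentokh-Rothman, *Decay for solutions of the wave equation
  on Kerr exterior spacetimes III: the full subextremal case `|a| < M`*, Ann. of Math. 183 (2016)
  787–913, arXiv:1402.7034: Thm. 3.1 (23), §3.3 (p. 14), §2.3.2
  (key `DafermosRodnianskiShlapentokhrothman2014`).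
* M. Dafermos, I. Rodnianski, *Decay for solutions of the wave equation on Kerr exterior
  spacetimes I–II*, arXiv:1010.5132, §4.4 Def. 4.1, §4.6 Prop. 4.6.1
  (key `DafermosRodnianski2010KerrSmallA`).
* S. W. Hawking, G. F. R. Ellis, *The large scale structure of space-time*, CUP 1973, §4.3,
  Lemma 4.3.1 and the conservation theorem (key `HawkingEllis1973CUP`).
* R. P. Kerr, A. Schild (1965), §2 (`∂_{t*}` is Killing for the Kerr–Schild form)
  (key `KerrSchild1965`).
-/

noncomputable section

open Set Filter Metric MeasureTheory
open scoped Topology Manifold ContDiff ENNReal RealInnerProductSpace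

namespace Literature.Geometry.Lorentzian

/-! ## Between two uniformly spacelike graphs: the local energy estimate of the reduction to
admissible hypersurfaces (Dafermos–Rodnianski arXiv:1010.5132, Prop. 4.6.1)

### The weighted energy inequality along the linear interpolation of two graphs -/

namespace KerrSchild.Background

/-- **The weighted energy inequality between two uniformly spacelike graphs.** Let `B`, `U`, `K`,
`Φ`, `W` be as in `graphWeightedEnergy_le` and let `F₁ ≤ F₂` be two `C²` height functions of slope
`‖dF_i‖ ≤ 1 − c`, `0 < c ≤ 1`. Assume, on the wedge `{τ + F₁(x⃗) ≤ x⁰ ≤ τ + F₂(x⃗)} ∩ K`, the flux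
condition `∑(∂W)P ≤ 0` and the spatial bound `‖x⃗‖ ≤ ρ`, let `F₂ − F₁ ≤ L` on `{‖y‖ ≤ ρ}` and
`|∂g| ≤ D` on `K`. Then the weighted energies through the two graphs satisfy
`E_W[τ + F₂] ≤ E_W[τ + F₁] · e^{C L}`, `C = 192 (1 + Φ_B) D / c` — the later hypersurface is
controlled by the earlier one with a constant depending only on their maximal separation `L`.
Proof: Grönwall along the interpolating foliation `F_θ = F₁ + θ (F₂ − F₁)`, `θ ∈ [0, 1]` (all of
slope `≤ 1 − c`), using the divergence identity `E4.graphFlux_sub_eq_integral_divergence` between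
`F₁` and `F_θ` and the pointwise bound of `graphWeightedEnergy_le` with the factor `F₂ − F₁ ≤ L`.
This is the "local energy estimate between two admissible hypersurfaces" of the reduction
Dafermos–Rodnianski arXiv:1010.5132, §4.6, Prop. 4.6.1 (invoked in arXiv:1402.7034, §3.3), for
Kerr–Schild graphs; Hawking–Ellis 1973, §4.3, Lemma 4.3.1.
[cite: HawkingEllis1973CUP, §4.3 Lemma 4.3.1; DafermosRodnianski2010KerrSmallA, §4.6 Prop. 4.6.1] -/
theorem twoGraphWeightedEnergy_le (B : Background) {U K : Set E4} (hKc : IsClosed K) (hKU : K ⊆ U)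
    {Φ W : E4 → ℝ} (hΦ : ∀ x ∈ U, ContDiffAt ℝ 2 Φ x) (hW : ContDiff ℝ 1 W)
    (hW0 : ∀ x, 0 ≤ W x) (hWK : ∀ x, W x ≠ 0 → x ∈ K)
    (hsol : ∀ x ∈ K, waveOperator B.inverseMetric Φ x = 0)
    {F₁ F₂ : E3 → ℝ} (hF₁ : ContDiff ℝ 2 F₁) (hF₂ : ContDiff ℝ 2 F₂) (hle : ∀ y, F₁ y ≤ F₂ y)
    {c : ℝ} (hc : 0 < c) (hc1 : c ≤ 1)
    (hF₁s : ∀ y, ‖fderiv ℝ F₁ y‖ ≤ 1 - c) (hF₂s : ∀ y, ‖fderiv ℝ F₂ y‖ ≤ 1 - c) {τ : ℝ}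
    (hflux : ∀ x ∈ K, τ + F₁ (E4.spatial x) ≤ x 0 → x 0 ≤ τ + F₂ (E4.spatial x) →
      ∑ μ, fderiv ℝ W x (E4.basisVector μ) * normalCurrent B.inverseMetric Φ x μ ≤ 0)
    {ρ L D : ℝ}
    (hρ : ∀ x ∈ K, τ + F₁ (E4.spatial x) ≤ x 0 → x 0 ≤ τ + F₂ (E4.spatial x) →
      E4.spatialNorm x ≤ ρ)
    (hL : ∀ y : E3, ‖y‖ ≤ ρ → F₂ y - F₁ y ≤ L) (hL0 : 0 ≤ L) (hD0 : 0 ≤ D)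
    (hD : ∀ x ∈ K, ∀ μ α β, |fderiv ℝ (fun y ↦ B.inverseMetric y α β) x (E4.basisVector μ)| ≤ D) :
    (∫ y in closedBall (0 : E3) ρ, W (E4.ofTimeSpace (τ + F₂ y) y) *
        ∑ μ, Kerr.graphConormal F₂ y μ *
          normalCurrent B.inverseMetric Φ (E4.ofTimeSpace (τ + F₂ y) y) μ) ≤
      (∫ y in closedBall (0 : E3) ρ, W (E4.ofTimeSpace (τ + F₁ y) y) *
        ∑ μ, Kerr.graphConormal F₁ y μ *
          normalCurrent B.inverseMetric Φ (E4.ofTimeSpace (τ + F₁ y) y) μ) *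
        Real.exp (192 * (1 + B.bound) * D / c * L) := by
  -- ### notation
  set G := B.inverseMetric with hG
  set Φb := B.bound with hΦb
  have hΦb0 : 0 ≤ Φb := (B.φ_nonneg 0).trans (B.φ_le 0)
  set P : Fin 4 → E4 → ℝ := fun μ x ↦ normalCurrent G Φ x μ with hP
  set J : Fin 4 → E4 → ℝ := fun μ x ↦ W x * P μ x with hJ
  set b : E4 → ℝ := fun x ↦ (∑ μ, fderiv ℝ W x (E4.basisVector μ) * P μ x) +
    W x * deformationTerm G Φ x with hb
  -- the gap and the interpolating heights
  set Gap : E3 → ℝ := fun y ↦ F₂ y - F₁ y with hGap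
  have hGap0 : ∀ y, 0 ≤ Gap y := fun y ↦ sub_nonneg.mpr (hle y)
  have hGap2 : ContDiff ℝ 2 Gap := hF₂.sub hF₁
  set Fθ : ℝ → E3 → ℝ := fun θ y ↦ F₁ y + θ * Gap y with hFθ
  have hFθ2 : ∀ θ, ContDiff ℝ 2 (Fθ θ) := fun θ ↦ hF₁.add (contDiff_const.mul hGap2)
  have hF₁d : ∀ y, DifferentiableAt ℝ F₁ y := fun y ↦ (hF₁.differentiable two_ne_zero) y
  have hF₂d : ∀ y, DifferentiableAt ℝ F₂ y := fun y ↦ (hF₂.differentiable two_ne_zero) y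
  have hFθd : ∀ θ y, fderiv ℝ (Fθ θ) y = (1 - θ) • fderiv ℝ F₁ y + θ • fderiv ℝ F₂ y := by
    intro θ y
    have hfun : Fθ θ = fun y ↦ (1 - θ) * F₁ y + θ * F₂ y := by
      funext y; simp only [hFθ, hGap]; ring
    rw [hfun]
    exact (((hF₁d y).hasFDerivAt.const_mul (1 - θ)).add
      ((hF₂d y).hasFDerivAt.const_mul θ)).fderiv
  have hFθs : ∀ θ, 0 ≤ θ → θ ≤ 1 → ∀ y, ‖fderiv ℝ (Fθ θ) y‖ ≤ 1 - c := by
    intro θ h0 h1 y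
    rw [hFθd]
    calc ‖(1 - θ) • fderiv ℝ F₁ y + θ • fderiv ℝ F₂ y‖
        ≤ ‖(1 - θ) • fderiv ℝ F₁ y‖ + ‖θ • fderiv ℝ F₂ y‖ := norm_add_le _ _
      _ = (1 - θ) * ‖fderiv ℝ F₁ y‖ + θ * ‖fderiv ℝ F₂ y‖ := by
          rw [norm_smul, norm_smul, Real.norm_of_nonneg (by linarith), Real.norm_of_nonneg h0]
      _ ≤ (1 - θ) * (1 - c) + θ * (1 - c) :=
          add_le_add (mul_le_mul_of_nonneg_left (hF₁s y) (by linarith))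
            (mul_le_mul_of_nonneg_left (hF₂s y) h0)
      _ = 1 - c := by ring
  have hFθcomp : ∀ θ, 0 ≤ θ → θ ≤ 1 → ∀ y, ∑ i, Kerr.partialE3 (Fθ θ) y i ^ 2 ≤ (1 - c) ^ 2 :=
    fun θ h0 h1 y ↦ (Kerr.sum_sq_partialE3_le (Fθ θ) y).trans
      (pow_le_pow_left₀ (norm_nonneg _) (hFθs θ h0 h1 y) 2)
  have hFθle₁ : ∀ θ, 0 ≤ θ → ∀ y, F₁ y ≤ Fθ θ y := fun θ h0 y ↦ by
    simp only [hFθ]; nlinarith [hGap0 y]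
  have hFθle₂ : ∀ θ, θ ≤ 1 → ∀ y, Fθ θ y ≤ F₂ y := fun θ h1 y ↦ by
    simp only [hFθ, hGap]; nlinarith [hGap0 y, hle y]
  have hθ1 : Fθ 1 = F₂ := by funext y; simp only [hFθ, hGap]; ring
  have hθ0 : Fθ 0 = F₁ := by funext y; simp only [hFθ]; ring
  -- ### regularity of the weighted current
  have hP1 : ∀ μ, ∀ x ∈ U, ContDiffAt ℝ 1 (P μ) x := fun μ x hx ↦
    B.contDiffAt_normalCurrent (hΦ x hx) μ
  have hJ1 : ∀ μ, ContDiff ℝ 1 (J μ) := fun μ ↦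
    contDiff_iff_contDiffAt.mpr fun x ↦ contDiffAt_weight_mul hKc hKU hW hWK (hP1 μ) x
  have hJc : ∀ μ, Continuous (J μ) := fun μ ↦ (hJ1 μ).continuous
  have hWz : ∀ x, x ∉ K → W x = 0 := fun x hx ↦ by
    by_contra h; exact hx (hWK x h)
  have hdW0 : ∀ x, x ∉ K → fderiv ℝ W x = 0 := fun x hx ↦ fderiv_eq_zero_of_notMem hKc hWK hx
  have hJ0 : ∀ μ x, x ∉ K → J μ x = 0 := fun μ x hx ↦ by
    simp only [hJ, hWz x hx, zero_mul]
  have hdJ0 : ∀ μ x, x ∉ K → fderiv ℝ (J μ) x = 0 := fun μ x hx ↦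
    fderiv_eq_zero_of_forall_mem_eq_zero hKc.isOpen_compl (fun y hy ↦ hJ0 μ y hy) hx
  have hbz : ∀ x, x ∉ K → b x = 0 := fun x hx ↦ by
    simp only [hb, hdW0 x hx, hWz x hx, zero_apply, zero_mul, Finset.sum_const_zero, add_zero]
  have hbc : Continuous b := by
    have h1 : ∀ μ, Continuous fun x ↦ fderiv ℝ W x (E4.basisVector μ) * P μ x := fun μ ↦
      continuous_iff_continuousAt.mpr fun x ↦ continuousAt_weight_mul hKc hKU
        ((hW.continuous_fderiv one_ne_zero).clm_apply continuous_const)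
        (fun y hy ↦ by rw [hdW0 y hy]; rfl) (fun y hy ↦ (hP1 μ y hy).continuousAt) x
    have h2 : Continuous fun x ↦ W x * deformationTerm G Φ x :=
      continuous_iff_continuousAt.mpr fun x ↦ continuousAt_weight_mul hKc hKU hW.continuous hWz
        (fun y hy ↦ (B.contDiffAt_deformationTerm (hΦ y hy)).continuousAt) x
    exact (continuous_finsetSum _ fun μ _ ↦ h1 μ).add h2
  -- ### the divergence of the weighted current: `∑ ∂_μ J^μ = b` everywhere
  have hdivJ : ∀ x, ∑ μ, fderiv ℝ (J μ) x (E4.basisVector μ) = b x := by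
    intro x
    by_cases hxK : x ∈ K
    · have hxU : x ∈ U := hKU hxK
      have hPd : ∀ μ, DifferentiableAt ℝ (P μ) x := fun μ ↦
        (hP1 μ x hxU).differentiableAt one_ne_zero
      have hWd : DifferentiableAt ℝ W x := (hW.differentiable one_ne_zero) x
      have hprod : ∀ μ κ, fderiv ℝ (J μ) x (E4.basisVector κ) =
          fderiv ℝ W x (E4.basisVector κ) * P μ x + W x * fderiv ℝ (P μ) x (E4.basisVector κ) := by
        intro μ κ
        have : J μ = fun y ↦ W y * P μ y := rfl
        rw [this, fderiv_fun_mul hWd (hPd μ)]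
        simp only [add_apply, FunLike.coe_smul, Pi.smul_apply, smul_eq_mul]
        ring
      have hsum : ∑ μ, fderiv ℝ (J μ) x (E4.basisVector μ) =
          (∑ μ, fderiv ℝ W x (E4.basisVector μ) * P μ x) +
            W x * ∑ μ, fderiv ℝ (P μ) x (E4.basisVector μ) := by
        simp only [hprod, Finset.sum_add_distrib, Finset.mul_sum]
      have hdivP := sum_fderiv_normalCurrent (B.differentiableAt_inverseMetric x)
        (B.inverseMetric_symm x) (hΦ x hxU)
      have hdivP' : ∑ μ, fderiv ℝ (P μ) x (E4.basisVector μ) = deformationTerm G Φ x := by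
        have h := hdivP
        rw [hsol x hxK, zero_mul, zero_add] at h
        exact h
      rw [hsum, hdivP']
    · rw [hbz x hxK]
      simp only [hdJ0 _ x hxK, zero_apply, Finset.sum_const_zero]
  -- ### the constant and the pointwise bound on the wedge, for an arbitrary spacelike conormal
  set C : ℝ := 192 * (1 + Φb) * D / c with hC
  have hC0 : 0 ≤ C := by positivity
  have hpt : ∀ (H : E3 → ℝ) (y : E3) (x : E4), (∑ i, Kerr.partialE3 H y i ^ 2 ≤ (1 - c) ^ 2) →
      τ + F₁ (E4.spatial x) ≤ x 0 → x 0 ≤ τ + F₂ (E4.spatial x) →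
        b x ≤ C * (W x * ∑ μ, Kerr.graphConormal H y μ * P μ x) := by
    intro H y x hH hx0 hxT
    by_cases hxK : x ∈ K
    · have hfl := hflux x hxK hx0 hxT
      have hR := B.abs_deformationTerm_le Φ x hD0 (hD x hxK)
      have hcoer := B.sum_sq_le_six_mul_normalCurrent_zero Φ x
      have hgr := B.mul_normalCurrent_zero_le_graphFlux Φ x hc hc1 hH
      have hWx := hW0 x
      have h3 : deformationTerm G Φ x ≤ 192 * (1 + Φb) * D * normalCurrent G Φ x 0 := by
        have := le_abs_self (deformationTerm G Φ x)
        have h4 : 32 * (1 + Φb) * D * ∑ μ, fderiv ℝ Φ x (E4.basisVector μ) ^ 2 ≤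
            32 * (1 + Φb) * D * (6 * normalCurrent G Φ x 0) :=
          mul_le_mul_of_nonneg_left hcoer (by positivity)
        linarith
      have h6 : normalCurrent G Φ x 0 ≤ (∑ μ, Kerr.graphConormal H y μ * P μ x) / c := by
        rw [le_div_iff₀ hc, mul_comm]
        exact hgr
      have h5 : W x * deformationTerm G Φ x ≤ W x * (192 * (1 + Φb) * D *
          ((∑ μ, Kerr.graphConormal H y μ * P μ x) / c)) :=
        mul_le_mul_of_nonneg_left (h3.trans (mul_le_mul_of_nonneg_left h6 (by positivity))) hWx
      calc b x = (∑ μ, fderiv ℝ W x (E4.basisVector μ) * P μ x) +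
            W x * deformationTerm G Φ x := rfl
        _ ≤ 0 + W x * (192 * (1 + Φb) * D *
            ((∑ μ, Kerr.graphConormal H y μ * P μ x) / c)) := add_le_add hfl h5
        _ = C * (W x * ∑ μ, Kerr.graphConormal H y μ * P μ x) := by rw [hC]; field_simp; ring
    · have hq : W x * ∑ μ, Kerr.graphConormal H y μ * P μ x = 0 := by rw [hWz x hxK, zero_mul]
      rw [hbz x hxK, hq, mul_zero]
  -- the graph flux density (of any spacelike-enough conormal) is nonnegative
  have hfluxH0 : ∀ (H : E3 → ℝ) (y : E3) (x : E4), (∑ i, Kerr.partialE3 H y i ^ 2 ≤ (1 - c) ^ 2) →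
      0 ≤ W x * ∑ μ, Kerr.graphConormal H y μ * P μ x := by
    intro H y x hH
    have h := B.mul_normalCurrent_zero_le_graphFlux Φ x hc hc1 hH
    have hP0 : 0 ≤ P 0 x := B.normalCurrent_zero_nonneg Φ x
    exact mul_nonneg (hW0 x) (le_trans (mul_nonneg hc.le hP0) h)
  -- ### vanishing beyond the spatial radius `ρ` on the wedge
  have hfar : ∀ x : E4, ρ < E4.spatialNorm x → τ + F₁ (E4.spatial x) ≤ x 0 →
      x 0 ≤ τ + F₂ (E4.spatial x) → x ∉ K := by
    intro x hxρ hx0 hxT hxK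
    exact absurd (hρ x hxK hx0 hxT) (not_le.mpr hxρ)
  -- points of the interpolating graphs lie in the wedge
  have hwedge : ∀ θ, 0 ≤ θ → θ ≤ 1 → ∀ y : E3,
      τ + F₁ (E4.spatial (E4.ofTimeSpace (τ + Fθ θ y) y)) ≤ (E4.ofTimeSpace (τ + Fθ θ y) y) 0 ∧
        (E4.ofTimeSpace (τ + Fθ θ y) y) 0 ≤ τ + F₂ (E4.spatial (E4.ofTimeSpace (τ + Fθ θ y) y)) := by
    intro θ h0 h1 y
    simp only [E4.spatial_ofTimeSpace, E4.ofTimeSpace_apply_zero]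
    exact ⟨by linarith [hFθle₁ θ h0 y], by linarith [hFθle₂ θ h1 y]⟩
  have hout : ∀ (h : E4 → ℝ), (∀ x, x ∉ K → h x = 0) → ∀ θ, 0 ≤ θ → θ ≤ 1 → ∀ y : E3,
      y ∉ closedBall (0 : E3) ρ → h (E4.ofTimeSpace (τ + Fθ θ y) y) = 0 := by
    intro h hh θ h0 h1 y hy
    refine hh _ (hfar _ ?_ (hwedge θ h0 h1 y).1 (hwedge θ h0 h1 y).2)
    rw [mem_closedBall, dist_zero_right, not_le] at hy
    rwa [E4.spatialNorm_ofTimeSpace]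
  -- ### the flux densities along the interpolation and their continuity
  set q : ℝ → E3 → ℝ := fun θ y ↦ ∑ μ, J μ (E4.ofTimeSpace (τ + Fθ θ y) y) *
    Kerr.graphConormal (Fθ θ) y μ with hq
  have hqW : ∀ θ y, q θ y = W (E4.ofTimeSpace (τ + Fθ θ y) y) *
      ∑ μ, Kerr.graphConormal (Fθ θ) y μ * P μ (E4.ofTimeSpace (τ + Fθ θ y) y) := by
    intro θ y
    simp only [hq, hJ, Finset.mul_sum]
    exact Finset.sum_congr rfl fun μ _ ↦ by ring
  have hq0 : ∀ θ, 0 ≤ θ → θ ≤ 1 → ∀ y, 0 ≤ q θ y := fun θ h0 h1 y ↦ by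
    rw [hqW]; exact hfluxH0 _ _ _ (hFθcomp θ h0 h1 y)
  have hqz : ∀ θ, 0 ≤ θ → θ ≤ 1 → ∀ y : E3, y ∉ closedBall (0 : E3) ρ → q θ y = 0 := by
    intro θ h0 h1 y hy
    rw [hqW, hout W hWz θ h0 h1 y hy, zero_mul]
  have hptc : Continuous fun p : ℝ × E3 ↦ E4.ofTimeSpace (τ + Fθ p.1 p.2) p.2 := by
    refine E4.continuous_ofTimeSpace' ?_ continuous_snd
    show Continuous fun p : ℝ × E3 ↦ τ + (F₁ p.2 + p.1 * Gap p.2)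
    exact continuous_const.add ((hF₁.continuous.comp continuous_snd).add
      (continuous_fst.mul (hGap2.continuous.comp continuous_snd)))
  have hnθ : ∀ μ, Continuous fun p : ℝ × E3 ↦ Kerr.graphConormal (Fθ p.1) p.2 μ := by
    intro μ
    refine Fin.cases ?_ (fun i ↦ ?_) μ
    · simp only [Kerr.graphConormal_zero]; exact continuous_const
    · have hfun : (fun p : ℝ × E3 ↦ Kerr.graphConormal (Fθ p.1) p.2 i.succ) = fun p ↦
          -((1 - p.1) * fderiv ℝ F₁ p.2 (EuclideanSpace.single i 1) +
            p.1 * fderiv ℝ F₂ p.2 (EuclideanSpace.single i 1)) := by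
        funext p
        rw [Kerr.graphConormal_succ, Kerr.partialE3, hFθd]
        rfl
      rw [hfun]
      have hA : ∀ (H : E3 → ℝ), ContDiff ℝ 2 H →
          Continuous fun p : ℝ × E3 ↦ fderiv ℝ H p.2 (EuclideanSpace.single i 1) := fun H hH ↦
        ((hH.continuous_fderiv two_ne_zero).comp continuous_snd).clm_apply continuous_const
      exact (((continuous_const.sub continuous_fst).mul (hA F₁ hF₁)).add
        (continuous_fst.mul (hA F₂ hF₂))).neg
  have hqc : Continuous fun p : ℝ × E3 ↦ q p.1 p.2 := by
    simp only [hq]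
    exact continuous_finsetSum _ fun μ _ ↦ ((hJc μ).comp hptc).mul (hnθ μ)
  -- ### the slice functions
  set f : ℝ → ℝ := fun θ ↦ ∫ y in closedBall (0 : E3) ρ, q θ y with hf
  set g : ℝ → ℝ := fun θ ↦ ∫ y in closedBall (0 : E3) ρ, Gap y * b (E4.ofTimeSpace (τ + Fθ θ y) y)
    with hg
  have hfc : Continuous f :=
    continuous_parametric_integral_of_continuous (f := q) hqc (isCompact_closedBall _ _)
  have hgc : Continuous g :=
    continuous_parametric_integral_of_continuous (f := fun (θ : ℝ) (y : E3) ↦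
      Gap y * b (E4.ofTimeSpace (τ + Fθ θ y) y))
      ((hGap2.continuous.comp continuous_snd).mul (hbc.comp hptc)) (isCompact_closedBall _ _)
  have hf0 : ∀ θ, 0 ≤ θ → θ ≤ 1 → 0 ≤ f θ := fun θ h0 h1 ↦
    setIntegral_nonneg measurableSet_closedBall fun y _ ↦ hq0 θ h0 h1 y
  -- the statement is about `f 1` and `f 0`
  have hstat : ∀ (H : E3 → ℝ) (θ : ℝ), Fθ θ = H →
      (∫ y in closedBall (0 : E3) ρ, W (E4.ofTimeSpace (τ + H y) y) *
        ∑ μ, Kerr.graphConormal H y μ * normalCurrent B.inverseMetric Φ (E4.ofTimeSpace (τ + H y) y) μ)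
        = f θ := by
    intro H θ hH
    rw [hf]
    refine setIntegral_congr_fun measurableSet_closedBall fun y _ ↦ ?_
    rw [hqW, hH]
  rw [hstat F₂ 1 hθ1, hstat F₁ 0 hθ0]
  -- ### the divergence identity between `F₁` and `F_θ₁`, `0 ≤ θ₁ ≤ 1`
  have hE3f : ∀ θ, 0 ≤ θ → θ ≤ 1 → (∫ y, q θ y) = f θ := by
    intro θ h0 h1
    rw [hf]
    exact (setIntegral_eq_integral_of_forall_compl_eq_zero (fun y hy ↦ hqz θ h0 h1 y hy)).symm
  have hE3g : ∀ θ, 0 ≤ θ → θ ≤ 1 →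
      (∫ y, Gap y * b (E4.ofTimeSpace (τ + Fθ θ y) y)) = g θ := by
    intro θ h0 h1
    rw [hg]
    refine (setIntegral_eq_integral_of_forall_compl_eq_zero (fun y hy ↦ ?_)).symm
    rw [hout b hbz θ h0 h1 y hy, mul_zero]
  have hident : ∀ θ₁, 0 ≤ θ₁ → θ₁ ≤ 1 →
      f θ₁ - f 0 = ∫ θ' in Set.Ioc (0 : ℝ) 1, θ₁ * g (θ' * θ₁) := by
    intro θ₁ h0 h1
    have hJ0' : ∀ μ (x : E4), ρ < E4.spatialNorm x → τ + F₁ (E4.spatial x) ≤ x 0 →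
        x 0 ≤ τ + Fθ θ₁ (E4.spatial x) → J μ x = 0 := fun μ x hxρ hx0 hx1 ↦
      hJ0 μ x (hfar x hxρ hx0 (hx1.trans (by linarith [hFθle₂ θ₁ h1 (E4.spatial x)])))
    have hid := E4.graphFlux_sub_eq_integral_divergence hJ1 hF₁ (hFθ2 θ₁) (hFθle₁ θ₁ h0)
      (τ := τ) (ρ := ρ) hJ0'
    have hgap : ∀ y, Fθ θ₁ y - F₁ y = θ₁ * Gap y := fun y ↦ by simp only [hFθ]; ring
    have hL1 : (∫ y, ∑ μ, J μ (E4.ofTimeSpace (τ + Fθ θ₁ y) y) *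
        Kerr.graphConormal (Fθ θ₁) y μ) = f θ₁ := hE3f θ₁ h0 h1
    have hL2 : (∫ y, ∑ μ, J μ (E4.ofTimeSpace (τ + F₁ y) y) * Kerr.graphConormal F₁ y μ) = f 0 := by
      rw [← hE3f 0 le_rfl zero_le_one]
      simp only [hq, hθ0]
    have hR : (∫ θ' in Set.Ioc (0 : ℝ) 1, ∫ y, (Fθ θ₁ y - F₁ y) *
        ∑ μ, fderiv ℝ (J μ) (E4.ofTimeSpace (τ + (F₁ y + θ' * (Fθ θ₁ y - F₁ y))) y)
          (E4.basisVector μ)) = ∫ θ' in Set.Ioc (0 : ℝ) 1, θ₁ * g (θ' * θ₁) := by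
      refine setIntegral_congr_fun measurableSet_Ioc fun θ' hθ' ↦ ?_
      have hθθ0 : 0 ≤ θ' * θ₁ := mul_nonneg hθ'.1.le h0
      have hθθ1 : θ' * θ₁ ≤ 1 := by nlinarith [hθ'.1, hθ'.2]
      have hpt : ∀ y, E4.ofTimeSpace (τ + (F₁ y + θ' * (Fθ θ₁ y - F₁ y))) y =
          E4.ofTimeSpace (τ + Fθ (θ' * θ₁) y) y := by
        intro y; simp only [hFθ]; ring_nf
      simp only [hdivJ, hgap]
      have hpt' : ∀ y, E4.ofTimeSpace (τ + (F₁ y + θ' * (θ₁ * Gap y))) y =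
          E4.ofTimeSpace (τ + Fθ (θ' * θ₁) y) y := by
        intro y; simp only [hFθ]; ring_nf
      simp only [hpt']
      have : (fun y ↦ θ₁ * Gap y * b (E4.ofTimeSpace (τ + Fθ (θ' * θ₁) y) y)) =
          fun y ↦ θ₁ * (Gap y * b (E4.ofTimeSpace (τ + Fθ (θ' * θ₁) y) y)) := by
        funext y; ring
      rw [this, MeasureTheory.integral_const_mul, hE3g _ hθθ0 hθθ1]
    rw [← hL1, ← hL2, ← hR]
    exact hid
  -- ### the substitution `u = θ' θ₁`
  have hsub : ∀ t, 0 ≤ t → ∫ θ' in Set.Ioc (0 : ℝ) 1, t * g (θ' * t) = ∫ u in Set.Ioc 0 t, g u := by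
    intro t ht0
    have h := intervalIntegral.smul_integral_comp_mul_right (f := g) (a := 0) (b := 1) t
    rw [smul_eq_mul, zero_mul, one_mul] at h
    rw [← intervalIntegral.integral_of_le zero_le_one, ← intervalIntegral.integral_of_le ht0,
      intervalIntegral.integral_const_mul, h]
  -- ### the integral inequality `f θ ≤ f 0 + ∫_0^θ (C L) f` on `[0, 1]`
  have hineq : ∀ t, 0 ≤ t → t ≤ 1 → f t ≤ f 0 + ∫ u in Set.Ioc 0 t, (C * L) * f u := by
    intro t ht0 ht1
    have hid' : f t - f 0 = ∫ u in Set.Ioc 0 t, g u := by rw [hident t ht0 ht1, hsub t ht0]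
    have hmono : ∫ u in Set.Ioc 0 t, g u ≤ ∫ u in Set.Ioc 0 t, (C * L) * f u := by
      refine setIntegral_mono_on (hgc.integrableOn_Icc.mono_set Set.Ioc_subset_Icc_self)
        ((continuous_const.mul hfc).integrableOn_Icc.mono_set Set.Ioc_subset_Icc_self)
        measurableSet_Ioc fun u hu ↦ ?_
      have hu0 : 0 ≤ u := hu.1.le
      have hu1 : u ≤ 1 := hu.2.trans ht1
      have hptu : Continuous fun y : E3 ↦ E4.ofTimeSpace (τ + Fθ u y) y :=
        hptc.comp (Continuous.prodMk_right u)
      have hi1 : IntegrableOn (fun y : E3 ↦ Gap y * b (E4.ofTimeSpace (τ + Fθ u y) y))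
          (closedBall (0 : E3) ρ) :=
        (hGap2.continuous.mul (hbc.comp hptu)).continuousOn.integrableOn_compact
          (isCompact_closedBall _ _)
      have hi2 : IntegrableOn (fun y : E3 ↦ (C * L) * q u y) (closedBall (0 : E3) ρ) :=
        (continuous_const.mul (hqc.comp (Continuous.prodMk_right u))).continuousOn.integrableOn_compact
          (isCompact_closedBall _ _)
      calc g u ≤ ∫ y in closedBall (0 : E3) ρ, (C * L) * q u y := by
            refine setIntegral_mono_on hi1 hi2 measurableSet_closedBall fun y hy ↦ ?_
            rw [mem_closedBall, dist_zero_right] at hy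
            have hb := hpt (Fθ u) y (E4.ofTimeSpace (τ + Fθ u y) y) (hFθcomp u hu0 hu1 y)
              (hwedge u hu0 hu1 y).1 (hwedge u hu0 hu1 y).2
            have hqnn := hq0 u hu0 hu1 y
            rw [← hqW] at hb
            have hGy := hGap0 y
            have hGL := hL y hy
            calc Gap y * b (E4.ofTimeSpace (τ + Fθ u y) y) ≤ Gap y * (C * q u y) :=
                  mul_le_mul_of_nonneg_left hb hGy
              _ ≤ L * (C * q u y) :=
                  mul_le_mul_of_nonneg_right hGL (mul_nonneg hC0 hqnn)
              _ = (C * L) * q u y := by ring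
        _ = (C * L) * f u := by
            rw [hf, ← MeasureTheory.integral_const_mul]
    linarith
  -- ### Grönwall on `[0, 1]`, applied to the primitive `∫_0^u f`
  set C' : ℝ := C * L with hC'
  have hC'0 : 0 ≤ C' := mul_nonneg hC0 hL0
  by_cases hCz : C' = 0
  · have h := hineq 1 zero_le_one le_rfl
    simp only [hCz, zero_mul, integral_zero, add_zero] at h
    have : Real.exp (192 * (1 + Φb) * D / c * L) = 1 := by
      rw [show 192 * (1 + Φb) * D / c * L = C' from by rw [hC', hC], hCz, Real.exp_zero]
    rw [this, mul_one]
    exact h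
  have hCpos : 0 < C' := lt_of_le_of_ne hC'0 (Ne.symm hCz)
  set A : ℝ := f 0 with hA
  have hA0 : 0 ≤ A := hf0 0 le_rfl zero_le_one
  have hineq' : ∀ t, 0 ≤ t → t ≤ 1 → f t ≤ A + C' * ∫ u in (0 : ℝ)..t, f u := by
    intro t h0 h1
    have h := hineq t h0 h1
    rw [MeasureTheory.integral_const_mul] at h
    rw [intervalIntegral.integral_of_le h0]
    exact h
  set Fp : ℝ → ℝ := fun u ↦ ∫ t in (0 : ℝ)..u, f t with hFp
  have hFderiv : ∀ u, HasDerivAt Fp (f u) u := fun u ↦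
    intervalIntegral.integral_hasDerivAt_right (hfc.intervalIntegrable _ _)
      (hfc.stronglyMeasurableAtFilter _ _) hfc.continuousAt
  have hFcont : Continuous Fp := continuous_iff_continuousAt.mpr fun u ↦ (hFderiv u).continuousAt
  have hFp0 : ∀ u, 0 ≤ u → u ≤ 1 → 0 ≤ Fp u := fun u hu hu1 ↦ by
    rw [hFp]
    exact intervalIntegral.integral_nonneg hu fun t ht ↦ hf0 t ht.1 (ht.2.trans hu1)
  have hgron := norm_le_gronwallBound_of_norm_deriv_right_le (f := Fp) (f' := f) (δ := 0) (K := C')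
    (ε := A) (a := 0) (b := 1) hFcont.continuousOn (fun u _ ↦ (hFderiv u).hasDerivWithinAt)
    (by simp [hFp]) (fun u hu ↦ by
      rw [Real.norm_of_nonneg (hf0 u hu.1 hu.2.le), Real.norm_of_nonneg (hFp0 u hu.1 hu.2.le)]
      linarith [hineq' u hu.1 hu.2.le])
  have hFs : Fp 1 ≤ A / C' * (Real.exp (C' * 1) - 1) := by
    have h := hgron 1 ⟨zero_le_one, le_rfl⟩
    rw [Real.norm_of_nonneg (hFp0 1 zero_le_one le_rfl), gronwallBound_of_K_ne_0 hCpos.ne',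
      sub_zero] at h
    simpa using h
  have h1 := hineq' 1 zero_le_one le_rfl
  have h2 : C' * Fp 1 ≤ A * (Real.exp (C' * 1) - 1) := by
    have := mul_le_mul_of_nonneg_left hFs hCpos.le
    rwa [← mul_assoc, mul_div_cancel₀ _ hCpos.ne'] at this
  have hexp : Real.exp (192 * (1 + Φb) * D / c * L) = Real.exp (C' * 1) := by
    rw [mul_one, hC', hC]
  rw [hexp]
  nlinarith

/-- **The conservation theorem between two uniformly spacelike graphs (domain of dependence by the
energy method, weighted form).** In the setting of `twoGraphWeightedEnergy_le`, if moreover the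
Cauchy data vanish on the initial support, `dΦ = 0` on `{x⁰ = τ + F₁(x⃗)} ∩ {W ≠ 0}`, then `dΦ = 0`
at every point of the wedge `{τ + F₁(x⃗) ≤ x⁰ ≤ τ + F₂(x⃗)} ∩ {W ≠ 0}`: the point lies on an
intermediate graph `F_θ = F₁ + θ(F₂ − F₁)`, the weighted energy through which is
`≤ e^{CL} · E_W[τ + F₁] = 0`; its density is continuous, nonnegative and vanishes off the ball,
hence vanishes identically, and `W ≠ 0` at the point forces `c P⁰ ≤ ∑ n_μ P^μ = 0`, whence
`∑(∂Φ)² ≤ 6 P⁰ = 0`. Hawking–Ellis 1973, §4.3 (the conservation theorem).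
[cite: HawkingEllis1973CUP, §4.3 (Lemma 4.3.1 and the conservation theorem)] -/
theorem fderiv_eq_zero_of_twoGraphWeight (B : Background) {U K : Set E4} (hKc : IsClosed K)
    (hKU : K ⊆ U) {Φ W : E4 → ℝ} (hΦ : ∀ x ∈ U, ContDiffAt ℝ 2 Φ x) (hW : ContDiff ℝ 1 W)
    (hW0 : ∀ x, 0 ≤ W x) (hWK : ∀ x, W x ≠ 0 → x ∈ K)
    (hsol : ∀ x ∈ K, waveOperator B.inverseMetric Φ x = 0)
    {F₁ F₂ : E3 → ℝ} (hF₁ : ContDiff ℝ 2 F₁) (hF₂ : ContDiff ℝ 2 F₂) (hle : ∀ y, F₁ y ≤ F₂ y)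
    {c : ℝ} (hc : 0 < c) (hc1 : c ≤ 1)
    (hF₁s : ∀ y, ‖fderiv ℝ F₁ y‖ ≤ 1 - c) (hF₂s : ∀ y, ‖fderiv ℝ F₂ y‖ ≤ 1 - c) {τ : ℝ}
    (hflux : ∀ x ∈ K, τ + F₁ (E4.spatial x) ≤ x 0 → x 0 ≤ τ + F₂ (E4.spatial x) →
      ∑ μ, fderiv ℝ W x (E4.basisVector μ) * normalCurrent B.inverseMetric Φ x μ ≤ 0)
    {ρ L D : ℝ}
    (hρ : ∀ x ∈ K, τ + F₁ (E4.spatial x) ≤ x 0 → x 0 ≤ τ + F₂ (E4.spatial x) →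
      E4.spatialNorm x ≤ ρ)
    (hL : ∀ y : E3, ‖y‖ ≤ ρ → F₂ y - F₁ y ≤ L) (hL0 : 0 ≤ L) (hD0 : 0 ≤ D)
    (hD : ∀ x ∈ K, ∀ μ α β, |fderiv ℝ (fun y ↦ B.inverseMetric y α β) x (E4.basisVector μ)| ≤ D)
    (hdata : ∀ x, x 0 = τ + F₁ (E4.spatial x) → W x ≠ 0 → fderiv ℝ Φ x = 0)
    {x : E4} (hx1 : τ + F₁ (E4.spatial x) ≤ x 0) (hx2 : x 0 ≤ τ + F₂ (E4.spatial x))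
    (hWx : W x ≠ 0) : fderiv ℝ Φ x = 0 := by
  set G := B.inverseMetric with hG
  set y₀ : E3 := E4.spatial x with hy₀
  -- ### the intermediate graph through `x`
  have hGap0 : ∀ y, 0 ≤ F₂ y - F₁ y := fun y ↦ sub_nonneg.mpr (hle y)
  obtain ⟨θ, hθ0, hθ1, hθx⟩ : ∃ θ : ℝ, 0 ≤ θ ∧ θ ≤ 1 ∧ x 0 = τ + (F₁ y₀ + θ * (F₂ y₀ - F₁ y₀)) := by
    by_cases hg : F₂ y₀ - F₁ y₀ = 0
    · exact ⟨0, le_rfl, zero_le_one, by rw [zero_mul, add_zero]; linarith [sub_eq_zero.mp hg]⟩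
    · have hgpos : 0 < F₂ y₀ - F₁ y₀ := lt_of_le_of_ne (hGap0 y₀) (Ne.symm hg)
      refine ⟨(x 0 - τ - F₁ y₀) / (F₂ y₀ - F₁ y₀), div_nonneg (by linarith) hgpos.le,
        (div_le_one hgpos).mpr (by linarith), ?_⟩
      rw [div_mul_cancel₀ _ hg]; ring
  set H : E3 → ℝ := fun y ↦ F₁ y + θ * (F₂ y - F₁ y) with hH
  have hH2 : ContDiff ℝ 2 H := hF₁.add (contDiff_const.mul (hF₂.sub hF₁))
  have hF₁d : ∀ y, DifferentiableAt ℝ F₁ y := fun y ↦ (hF₁.differentiable two_ne_zero) y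
  have hF₂d : ∀ y, DifferentiableAt ℝ F₂ y := fun y ↦ (hF₂.differentiable two_ne_zero) y
  have hHs : ∀ y, ‖fderiv ℝ H y‖ ≤ 1 - c := by
    intro y
    have hfun : H = fun y ↦ (1 - θ) * F₁ y + θ * F₂ y := by
      funext y; simp only [hH]; ring
    have hHd : fderiv ℝ H y = (1 - θ) • fderiv ℝ F₁ y + θ • fderiv ℝ F₂ y := by
      rw [hfun]
      exact (((hF₁d y).hasFDerivAt.const_mul (1 - θ)).add
        ((hF₂d y).hasFDerivAt.const_mul θ)).fderiv
    rw [hHd]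
    calc ‖(1 - θ) • fderiv ℝ F₁ y + θ • fderiv ℝ F₂ y‖
        ≤ ‖(1 - θ) • fderiv ℝ F₁ y‖ + ‖θ • fderiv ℝ F₂ y‖ := norm_add_le _ _
      _ = (1 - θ) * ‖fderiv ℝ F₁ y‖ + θ * ‖fderiv ℝ F₂ y‖ := by
          rw [norm_smul, norm_smul, Real.norm_of_nonneg (by linarith), Real.norm_of_nonneg hθ0]
      _ ≤ (1 - θ) * (1 - c) + θ * (1 - c) :=
          add_le_add (mul_le_mul_of_nonneg_left (hF₁s y) (by linarith))
            (mul_le_mul_of_nonneg_left (hF₂s y) hθ0)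
      _ = 1 - c := by ring
  have hHcomp : ∀ y, ∑ i, Kerr.partialE3 H y i ^ 2 ≤ (1 - c) ^ 2 := fun y ↦
    (Kerr.sum_sq_partialE3_le H y).trans (pow_le_pow_left₀ (norm_nonneg _) (hHs y) 2)
  have hH₁ : ∀ y, F₁ y ≤ H y := fun y ↦ by simp only [hH]; nlinarith [hGap0 y]
  have hH₂ : ∀ y, H y ≤ F₂ y := fun y ↦ by simp only [hH]; nlinarith [hGap0 y]
  have hxH : x = E4.ofTimeSpace (τ + H y₀) y₀ := by
    have h : E4.ofTimeSpace (x 0) (E4.spatial x) = x := E4.ofTimeSpace_time_spatial x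
    rw [← h, hθx]
  -- ### the weighted energy through the graph of `H` vanishes
  have hle2 := B.twoGraphWeightedEnergy_le hKc hKU hΦ hW hW0 hWK hsol hF₁ hH2 hH₁ hc hc1 hF₁s hHs
    (τ := τ) (fun z hz h1 h2 ↦ hflux z hz h1 (h2.trans (by linarith [hH₂ (E4.spatial z)])))
    (ρ := ρ) (L := L) (D := D)
    (fun z hz h1 h2 ↦ hρ z hz h1 (h2.trans (by linarith [hH₂ (E4.spatial z)])))
    (fun y hy ↦ (sub_le_sub_right (hH₂ y) _).trans (hL y hy)) hL0 hD0 hD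
  set P : Fin 4 → E4 → ℝ := fun μ z ↦ normalCurrent G Φ z μ with hP
  set q : E3 → ℝ := fun y ↦ W (E4.ofTimeSpace (τ + H y) y) *
    ∑ μ, Kerr.graphConormal H y μ * P μ (E4.ofTimeSpace (τ + H y) y) with hq
  have hE1 : (∫ y in closedBall (0 : E3) ρ, W (E4.ofTimeSpace (τ + F₁ y) y) *
      ∑ μ, Kerr.graphConormal F₁ y μ * normalCurrent B.inverseMetric Φ (E4.ofTimeSpace (τ + F₁ y) y) μ)
        = 0 := by
    refine setIntegral_eq_zero_of_forall_eq_zero fun y _ ↦ ?_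
    by_cases hWy : W (E4.ofTimeSpace (τ + F₁ y) y) = 0
    · rw [hWy, zero_mul]
    · have hd := hdata _ (by rw [E4.ofTimeSpace_apply_zero, E4.spatial_ofTimeSpace]) hWy
      have h0 : ∀ μ, normalCurrent B.inverseMetric Φ (E4.ofTimeSpace (τ + F₁ y) y) μ = 0 := fun μ ↦
        normalCurrent_eq_zero_of_fderiv_eq_zero B.inverseMetric hd μ
      simp only [h0, mul_zero, Finset.sum_const_zero]
  have hq0 : ∀ y, 0 ≤ q y := by
    intro y
    have h := B.mul_normalCurrent_zero_le_graphFlux Φ (E4.ofTimeSpace (τ + H y) y) hc hc1 (hHcomp y)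
    have hP0 : 0 ≤ P 0 (E4.ofTimeSpace (τ + H y) y) := B.normalCurrent_zero_nonneg Φ _
    exact mul_nonneg (hW0 _) (le_trans (mul_nonneg hc.le hP0) h)
  have hqI : (∫ y in closedBall (0 : E3) ρ, q y) = 0 := by
    refine le_antisymm ?_ (setIntegral_nonneg measurableSet_closedBall fun y _ ↦ hq0 y)
    have h : (∫ y in closedBall (0 : E3) ρ, q y) ≤ 0 * _ := hE1 ▸ hle2
    simpa using h
  -- `q` is continuous, vanishes off the ball and has integral zero: it is zero
  have hWz : ∀ z, z ∉ K → W z = 0 := fun z hz ↦ by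
    by_contra h; exact hz (hWK z h)
  have hP1 : ∀ μ, ∀ z ∈ U, ContDiffAt ℝ 1 (P μ) z := fun μ z hz ↦
    B.contDiffAt_normalCurrent (hΦ z hz) μ
  have hJc : ∀ μ, Continuous fun z ↦ W z * P μ z := fun μ ↦
    (contDiff_iff_contDiffAt.mpr fun z ↦ contDiffAt_weight_mul hKc hKU hW hWK (hP1 μ) z).continuous
  have hptc : Continuous fun y : E3 ↦ E4.ofTimeSpace (τ + H y) y :=
    E4.continuous_ofTimeSpace' (continuous_const.add hH2.continuous) continuous_id
  have hnc : ∀ μ, Continuous fun y : E3 ↦ Kerr.graphConormal H y μ := by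
    intro μ
    refine Fin.cases ?_ (fun i ↦ ?_) μ
    · simp only [Kerr.graphConormal_zero]; exact continuous_const
    · simp only [Kerr.graphConormal_succ, Kerr.partialE3]
      exact ((hH2.continuous_fderiv two_ne_zero).clm_apply continuous_const).neg
  have hqc : Continuous q := by
    have : q = fun y ↦ ∑ μ, Kerr.graphConormal H y μ *
        (W (E4.ofTimeSpace (τ + H y) y) * P μ (E4.ofTimeSpace (τ + H y) y)) := by
      funext y
      simp only [hq, Finset.mul_sum]
      exact Finset.sum_congr rfl fun μ _ ↦ by ring
    rw [this]
    exact continuous_finsetSum _ fun μ _ ↦ (hnc μ).mul ((hJc μ).comp hptc)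
  have hqz : ∀ y : E3, y ∉ closedBall (0 : E3) ρ → q y = 0 := by
    intro y hy
    rw [mem_closedBall, dist_zero_right, not_le] at hy
    have hnot : E4.ofTimeSpace (τ + H y) y ∉ K := by
      intro hmem
      have := hρ _ hmem
        (by rw [E4.ofTimeSpace_apply_zero, E4.spatial_ofTimeSpace]; linarith [hH₁ y])
        (by rw [E4.ofTimeSpace_apply_zero, E4.spatial_ofTimeSpace]; linarith [hH₂ y])
      rw [E4.spatialNorm_ofTimeSpace] at this
      linarith
    show W (E4.ofTimeSpace (τ + H y) y) * _ = 0
    rw [hWz _ hnot, zero_mul]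
  have hint_all : ∫ y : E3, q y = 0 := by
    rw [← setIntegral_eq_integral_of_forall_compl_eq_zero hqz]
    exact hqI
  have hintegrable : Integrable q :=
    hqc.integrable_of_hasCompactSupport (HasCompactSupport.intro (isCompact_closedBall (0 : E3) ρ) hqz)
  have hae : q =ᵐ[volume] 0 := (integral_eq_zero_iff_of_nonneg (fun y ↦ hq0 y) hintegrable).mp hint_all
  have hfun : q = 0 := (hqc.ae_eq_iff_eq volume continuous_const).mp hae
  -- ### at the point `x`
  have hqx : q y₀ = 0 := congrFun hfun y₀
  rw [hq] at hqx
  simp only [← hxH] at hqx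
  rcases mul_eq_zero.mp hqx with h | h
  · exact absurd h hWx
  · have hlow := B.mul_normalCurrent_zero_le_graphFlux Φ x hc hc1 (hHcomp y₀)
    have hP0 : 0 ≤ normalCurrent G Φ x 0 := B.normalCurrent_zero_nonneg Φ x
    have hPx : normalCurrent G Φ x 0 = 0 := by
      refine le_antisymm ?_ hP0
      have : c * normalCurrent G Φ x 0 ≤ 0 := by rw [hG]; simpa [hP] using hlow.trans_eq h
      nlinarith
    have hsum : ∑ μ, fderiv ℝ Φ x (E4.basisVector μ) ^ 2 = 0 := by
      refine le_antisymm ?_ (Finset.sum_nonneg fun _ _ ↦ sq_nonneg _)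
      have := B.sum_sq_le_six_mul_normalCurrent_zero Φ x
      rw [← hG, hPx, mul_zero] at this
      exact this
    have hμ : ∀ μ, fderiv ℝ Φ x (E4.basisVector μ) = 0 := fun μ ↦
      (pow_eq_zero_iff two_ne_zero).mp
        ((Finset.sum_eq_zero_iff_of_nonneg fun μ _ ↦ sq_nonneg _).mp hsum μ (Finset.mem_univ μ))
    ext w
    rw [Kerr.eq_sum_basisVector w, map_sum]
    simp [hμ]

end KerrSchild.Background

/-! ### The energy estimate between two uniformly spacelike graphs on the Kerr exterior -/

namespace Kerr

/-- **Energy estimate between two uniformly spacelike graph hypersurfaces on the Kerr exterior, up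
to `𝓗⁺` (coordinate form).** For subextremal `(M, a)` there are `C₀ > 0`, `C₁ ≥ 0`
(`C₀ = 144 (1 + 4M/r₊)²`, `C₁ = 192 (1 + 4M/r₊) D(M, a)`) such that for all `C²` height functions
`F₁ ≤ F₂ ≤ F₁ + L` of slope `‖dF_i‖ ≤ 1 − c`, `0 < c ≤ 1`, every `Φ : ℝ⁴ → ℝ` of class `C²` at the
exterior points solving the Kerr wave equation there, and every `τ ∈ ℝ`,
`∫_{{t* = τ + F₂} ∩ {r > r₊}} ∑_μ (∂_μΦ)² dy ≤ (C₀/c) e^{(C₁/c) L} ∫_{{t* = τ + F₁} ∩ {r > r₊}} ∑_μ (∂_μΦ)² dy`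
in `[0, ∞]`: the energy through the later hypersurface is controlled by the energy through the
earlier one, with a constant depending only on their maximal `t*`-separation `L`. This is the local
energy estimate by which Dafermos–Rodnianski (arXiv:1010.5132, §4.6, Prop. 4.6.1; invoked in
arXiv:1402.7034, §3.3) transfer boundedness statements between different admissible foliations.
Proof: `KerrSchild.Background.twoGraphWeightedEnergy_le` with the weight `Kerr.graphWeight`, the
two-sided comparison of the graph flux with `∑(∂Φ)²`, and exhaustion of the later leaf.
[cite: HawkingEllis1973CUP, §4.3 Lemma 4.3.1; DafermosRodnianski2010KerrSmallA, §4.6 Prop. 4.6.1] -/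
theorem exterior_twoGraphCoordEnergy_le {M a : ℝ} (hMa : IsSubextremal M a) :
    ∃ C₀ C₁ : ℝ, 0 < C₀ ∧ 0 ≤ C₁ ∧ ∀ (F₁ F₂ : E3 → ℝ) (c L : ℝ),
      ContDiff ℝ 2 F₁ → ContDiff ℝ 2 F₂ → 0 < c → c ≤ 1 →
      (∀ y, ‖fderiv ℝ F₁ y‖ ≤ 1 - c) → (∀ y, ‖fderiv ℝ F₂ y‖ ≤ 1 - c) →
      (∀ y, F₁ y ≤ F₂ y) → (∀ y, F₂ y - F₁ y ≤ L) →
      ∀ Φ : E4 → ℝ,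
      (∀ x ∈ (exterior M a : Set E4), ContDiffAt ℝ 2 Φ x) →
      (∀ x ∈ (exterior M a : Set E4),
        KerrSchild.waveOperator
          (KerrSchild.inverseMetric (fun y ↦ 2 * scalarH M a y) (nullVector a)) Φ x = 0) →
      ∀ τ : ℝ,
        (∫⁻ y, {y : E3 | E4.ofTimeSpace (τ + F₂ y) y ∈ exterior M a}.indicator
            (fun y ↦ ENNReal.ofReal
              (∑ μ, fderiv ℝ Φ (E4.ofTimeSpace (τ + F₂ y) y) (E4.basisVector μ) ^ 2)) y) ≤
          ENNReal.ofReal (C₀ / c * Real.exp (C₁ / c * L)) *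
            ∫⁻ y, {y : E3 | E4.ofTimeSpace (τ + F₁ y) y ∈ exterior M a}.indicator
              (fun y ↦ ENNReal.ofReal
                (∑ μ, fderiv ℝ Φ (E4.ofTimeSpace (τ + F₁ y) y) (E4.basisVector μ) ^ 2)) y := by
  -- ### constants
  have hM : 0 < M := hMa.pos
  have hrp : 0 < rPlus M a := hMa.rPlus_pos
  set B := surgeryBackground M a (rPlus M a) hMa.pos.le hMa.rPlus_pos with hB
  obtain ⟨D, hD0, hD⟩ :=
    exists_bound_fderiv_surgeryBackground_inverseMetric hMa.pos.le a hMa.rPlus_pos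
  have hΦb0 : 0 ≤ B.bound := (B.φ_nonneg 0).trans (B.φ_le 0)
  refine ⟨144 * (1 + B.bound) ^ 2, 192 * (1 + B.bound) * D, by positivity, by positivity,
    fun F₁ F₂ c L hF₁ hF₂ hc hc1 hslope₁ hslope₂ hle hL Φ hΦ2 hsol τ ↦ ?_⟩
  have hL0 : 0 ≤ L := (sub_nonneg.mpr (hle 0)).trans (hL 0)
  -- ### the equation on the surgered background
  have hsolB : ∀ x ∈ (exterior M a : Set E4),
      KerrSchild.waveOperator B.inverseMetric Φ x = 0 := by
    intro x hx
    rw [← KerrSchild.waveOperator_congr_of_eventuallyEq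
      (surgeryBackground_inverseMetric_eventuallyEq M a hMa.pos.le hMa.rPlus_pos ⟨x, hx⟩) Φ]
    exact hsol x hx
  -- ### the slopes
  have hF₁d : Differentiable ℝ F₁ := hF₁.differentiable two_ne_zero
  have hF₂d : Differentiable ℝ F₂ := hF₂.differentiable two_ne_zero
  have hcomp : ∀ (F : E3 → ℝ), (∀ y, ‖fderiv ℝ F y‖ ≤ 1 - c) →
      ∀ y, ∑ i, partialE3 F y i ^ 2 ≤ (1 - c) ^ 2 := fun F hs y ↦
    (sum_sq_partialE3_le F y).trans (pow_le_pow_left₀ (norm_nonneg _) (hs y) 2)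
  have hdFi : ∀ (F : E3 → ℝ), (∀ y, ‖fderiv ℝ F y‖ ≤ 1 - c) → ∀ y i, |partialE3 F y i| ≤ 1 :=
    fun F hs y i ↦ (abs_partialE3_le F y i).trans ((hs y).trans (by linarith [hc.le]))
  have hF₁lip : ∀ y, (τ + F₁ 0) - (1 - c) * ‖y‖ ≤ τ + F₁ y := fun y ↦ by
    linarith [sub_mul_norm_le_of_norm_fderiv_le hF₁d hslope₁ y]
  have hF₂ub : ∀ y, F₂ y ≤ F₂ 0 + ‖y‖ := fun y ↦
    (le_add_mul_norm_of_norm_fderiv_le hF₂d hslope₂ y).trans (by nlinarith [norm_nonneg y, hc.le])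
  -- ### notation: densities and energies
  set P0 : E4 → ℝ := fun x ↦ KerrSchild.normalCurrent B.inverseMetric Φ x 0 with hP0
  set Q : (E3 → ℝ) → E4 → ℝ := fun F x ↦ ∑ μ, graphConormal F (E4.spatial x) μ *
    KerrSchild.normalCurrent B.inverseMetric Φ x μ with hQ
  set fd : (E3 → ℝ) → E3 → ℝ≥0∞ := fun F y ↦
    ENNReal.ofReal (∑ μ, fderiv ℝ Φ (E4.ofTimeSpace (τ + F y) y) (E4.basisVector μ) ^ 2) with hfd
  have hfm : ∀ (F : E3 → ℝ), Continuous F → Measurable (fd F) := fun F hF ↦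
    measurable_sum_sq_fderiv_graph Φ hF τ
  set E0 : ℝ≥0∞ := ∫⁻ y, {y : E3 | E4.ofTimeSpace (τ + F₁ y) y ∈ exterior M a}.indicator (fd F₁) y
    with hE0
  have hP0nn : ∀ x, 0 ≤ P0 x := fun x ↦ B.normalCurrent_zero_nonneg Φ x
  have hQlow : ∀ (F : E3 → ℝ), (∀ y, ‖fderiv ℝ F y‖ ≤ 1 - c) → ∀ x, c * P0 x ≤ Q F x :=
    fun F hs x ↦ B.mul_normalCurrent_zero_le_graphFlux Φ x hc hc1 (hcomp F hs (E4.spatial x))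
  have hQnn : ∀ (F : E3 → ℝ), (∀ y, ‖fderiv ℝ F y‖ ≤ 1 - c) → ∀ x, 0 ≤ Q F x := fun F hs x ↦
    (mul_nonneg hc.le (hP0nn x)).trans (hQlow F hs x)
  have hQup : ∀ (F : E3 → ℝ), (∀ y, ‖fderiv ℝ F y‖ ≤ 1 - c) → ∀ x,
      Q F x ≤ 24 * (1 + B.bound) ^ 2 * ∑ μ, fderiv ℝ Φ x (E4.basisVector μ) ^ 2 :=
    fun F hs x ↦ (le_abs_self _).trans (B.abs_graphFlux_le Φ x (hdFi F hs (E4.spatial x)))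
  have hlowQ : ∀ (F : E3 → ℝ), (∀ y, ‖fderiv ℝ F y‖ ≤ 1 - c) → ∀ x,
      ∑ μ, fderiv ℝ Φ x (E4.basisVector μ) ^ 2 ≤ 6 / c * Q F x := by
    intro F hs x
    have h1 := KerrSchild.Background.sum_sq_le_six_mul_normalCurrent_zero B Φ x
    have h2 : P0 x ≤ Q F x / c := by rw [le_div_iff₀ hc, mul_comm]; exact hQlow F hs x
    calc ∑ μ, fderiv ℝ Φ x (E4.basisVector μ) ^ 2 ≤ 6 * P0 x := h1
      _ ≤ 6 * (Q F x / c) := by gcongr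
      _ = 6 / c * Q F x := by ring
  -- continuity of `Q F` at the exterior points
  have hnc : ∀ (F : E3 → ℝ), ContDiff ℝ 2 F → ∀ μ,
      Continuous fun x ↦ graphConormal F (E4.spatial x) μ := by
    intro F hF μ
    refine Fin.cases ?_ (fun i ↦ ?_) μ
    · simp only [graphConormal_zero]; exact continuous_const
    · simp only [graphConormal_succ, partialE3]
      exact (((hF.continuous_fderiv two_ne_zero).comp E4.spatial.continuous).clm_apply
        continuous_const).neg
  have hQc : ∀ (F : E3 → ℝ), ContDiff ℝ 2 F → ∀ x ∈ (exterior M a : Set E4),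
      ContinuousAt (Q F) x := fun F hF x hx ↦
    tendsto_finsetSum _ fun μ _ ↦
      (hnc F hF μ).continuousAt.mul (B.contDiffAt_normalCurrent (hΦ2 x hx) μ).continuousAt
  -- the graph maps
  have hgraph : ∀ (F : E3 → ℝ), Continuous F →
      Continuous fun y : E3 ↦ E4.ofTimeSpace (τ + F y) y := fun F hF ↦
    E4.continuous_ofTimeSpace' (continuous_const.add hF) continuous_id
  -- ### Step 1: the estimate on `{‖y‖ ≤ R} ∩ {(r − r₊) e^{−(τ + F₂)/(2M)} ≥ 2ε}`
  have hcore : ∀ R ε : ℝ, 0 ≤ R → 0 < ε →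
      ∫⁻ y in {y : E3 | ‖y‖ ≤ R ∧ 2 * ε ≤ horizonFn M a (E4.ofTimeSpace (τ + F₂ y) y)}, fd F₂ y ≤
        ENNReal.ofReal (144 * (1 + B.bound) ^ 2 / c *
          Real.exp (192 * (1 + B.bound) * D / c * L)) * E0 := by
    intro R ε hR hε
    set A : ℝ := τ + F₂ 0 + 2 * R + 2 with hA
    have hAle : τ + F₂ 0 + 2 * R + 2 ≤ A := le_rfl
    set W : E4 → ℝ := graphWeight M a A ε with hW
    set K : Set E4 := graphWeightSet M a A ε with hK
    have hKc : IsClosed K := isClosed_graphWeightSet M a A ε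
    have hKU : K ⊆ (exterior M a : Set E4) := graphWeightSet_subset_exterior hrp hε
    have hWK : ∀ z, W z ≠ 0 → z ∈ K := fun z hz ↦ mem_graphWeightSet_of_ne_zero hε hz
    have hW1 : ContDiff ℝ 1 W := contDiff_graphWeight A hrp hε
    have hW0 : ∀ z, 0 ≤ W z := graphWeight_nonneg M a A ε
    have hWle : ∀ z, W z ≤ 1 := graphWeight_le_one M a A ε
    have hWz : ∀ z, z ∉ K → W z = 0 := fun z hz ↦ by
      by_contra h; exact hz (hWK z h)
    have hsolK : ∀ z ∈ K, KerrSchild.waveOperator B.inverseMetric Φ z = 0 := fun z hz ↦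
      hsolB z (hKU hz)
    have hflux : ∀ z ∈ K, τ + F₁ (E4.spatial z) ≤ z 0 → z 0 ≤ τ + F₂ (E4.spatial z) →
        ∑ μ, fderiv ℝ W z (E4.basisVector μ) * KerrSchild.normalCurrent B.inverseMetric Φ z μ
          ≤ 0 := fun z _ _ _ ↦ graphWeight_flux hMa Φ A hε z
    set ρ : ℝ := (A - (τ + F₁ 0)) / c with hρdef
    have hρ : ∀ z ∈ K, τ + F₁ (E4.spatial z) ≤ z 0 → z 0 ≤ τ + F₂ (E4.spatial z) →
        E4.spatialNorm z ≤ ρ := fun z hz h1 _ ↦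
      spatialNorm_le_of_mem_graphWeightSet hz hc (F := fun y ↦ τ + F₁ y) hF₁lip h1
    have hDK : ∀ z ∈ K, ∀ μ α β,
        |fderiv ℝ (fun y ↦ B.inverseMetric y α β) z (E4.basisVector μ)| ≤ D :=
      fun z _ μ α β ↦ hD z μ α β
    -- Grönwall along the interpolating foliation
    have hgron := B.twoGraphWeightedEnergy_le hKc hKU hΦ2 hW1 hW0 hWK hsolK hF₁ hF₂ hle hc hc1
      hslope₁ hslope₂ hflux hρ (fun y _ ↦ hL y) hL0 hD0 hDK
    -- the weighted flux densities are continuous, hence integrable on the ball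
    set WQ : (E3 → ℝ) → E4 → ℝ := fun F x ↦ W x * Q F x with hWQ
    have hWQc : ∀ (F : E3 → ℝ), ContDiff ℝ 2 F → Continuous (WQ F) := fun F hF ↦
      continuous_iff_continuousAt.mpr fun x ↦
        continuousAt_weight_mul hKc hKU hW1.continuous hWz (hQc F hF) x
    set J : (E3 → ℝ) → E3 → ℝ := fun F y ↦ W (E4.ofTimeSpace (τ + F y) y) *
      ∑ μ, graphConormal F y μ *
        KerrSchild.normalCurrent B.inverseMetric Φ (E4.ofTimeSpace (τ + F y) y) μ with hJ
    have hJWQ : ∀ F, J F = fun y ↦ WQ F (E4.ofTimeSpace (τ + F y) y) := by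
      intro F
      funext y
      simp only [hJ, hWQ, hQ, E4.spatial_ofTimeSpace]
    have hJc : ∀ (F : E3 → ℝ), ContDiff ℝ 2 F → Continuous (J F) := fun F hF ↦ by
      rw [hJWQ F]; exact (hWQc F hF).comp (hgraph F hF.continuous)
    have hJnn : ∀ (F : E3 → ℝ), (∀ y, ‖fderiv ℝ F y‖ ≤ 1 - c) → ∀ y, 0 ≤ J F y := fun F hs y ↦ by
      rw [hJWQ F]
      exact mul_nonneg (hW0 _) (hQnn F hs _)
    have hJi : ∀ (F : E3 → ℝ), ContDiff ℝ 2 F → IntegrableOn (J F) (closedBall (0 : E3) ρ) :=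
      fun F hF ↦ (hJc F hF).continuousOn.integrableOn_compact (isCompact_closedBall 0 ρ)
    -- the set and its properties
    set S : Set E3 := {y : E3 | ‖y‖ ≤ R ∧ 2 * ε ≤ horizonFn M a (E4.ofTimeSpace (τ + F₂ y) y)}
      with hS
    have hhc : Continuous fun y : E3 ↦ horizonFn M a (E4.ofTimeSpace (τ + F₂ y) y) := by
      show Continuous fun y : E3 ↦ (radius a (E4.ofTimeSpace (τ + F₂ y) y) - rPlus M a) *
        Real.exp (-((2 * M)⁻¹ * (τ + F₂ y)))
      exact (((continuous_radius a).comp (hgraph F₂ hF₂.continuous)).sub continuous_const).mul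
        (Real.continuous_exp.comp
          (continuous_const.mul (continuous_const.add hF₂.continuous)).neg)
    have hSm : MeasurableSet S :=
      ((isClosed_le continuous_norm continuous_const).inter
        (isClosed_le continuous_const hhc)).measurableSet
    have hSsub : S ⊆ closedBall (0 : E3) ρ := by
      intro y hy
      rw [mem_closedBall, dist_zero_right]
      have hy1 := hy.1
      have hn0 : 0 ≤ ‖y‖ := norm_nonneg y
      have h01 : F₁ 0 ≤ F₂ 0 := hle 0
      rw [hρdef, hA, le_div_iff₀ hc]
      nlinarith
    -- (i) lower bound on the later graph
    have h1 : ∫⁻ y in S, fd F₂ y ≤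
        ENNReal.ofReal (6 / c * ∫ y in closedBall (0 : E3) ρ, J F₂ y) := by
      calc ∫⁻ y in S, fd F₂ y ≤ ∫⁻ y in S, ENNReal.ofReal (6 / c * J F₂ y) := by
            refine setLIntegral_mono' hSm fun y hy ↦ ENNReal.ofReal_le_ofReal ?_
            have hWy : W (E4.ofTimeSpace (τ + F₂ y) y) = 1 :=
              graphWeight_eq_one hF₂ub hAle hy.1 hy.2 hε
            have := hlowQ F₂ hslope₂ (E4.ofTimeSpace (τ + F₂ y) y)
            simp only [hJ, hWy, one_mul]
            simpa only [hQ, E4.spatial_ofTimeSpace] using this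
        _ ≤ ∫⁻ y in closedBall (0 : E3) ρ, ENNReal.ofReal (6 / c * J F₂ y) :=
            lintegral_mono_set hSsub
        _ = ENNReal.ofReal (∫ y in closedBall (0 : E3) ρ, 6 / c * J F₂ y) :=
            (ofReal_integral_eq_lintegral_ofReal ((hJi F₂ hF₂).const_mul (6 / c))
              (ae_of_all _ fun y ↦ by positivity [hJnn F₂ hslope₂ y])).symm
        _ = ENNReal.ofReal (6 / c * ∫ y in closedBall (0 : E3) ρ, J F₂ y) := by
            rw [integral_const_mul]
    -- (ii) upper bound on the earlier graph
    have h2 : ENNReal.ofReal (∫ y in closedBall (0 : E3) ρ, J F₁ y) ≤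
        ENNReal.ofReal (24 * (1 + B.bound) ^ 2) * E0 := by
      rw [ofReal_integral_eq_lintegral_ofReal (hJi F₁ hF₁) (ae_of_all _ (hJnn F₁ hslope₁))]
      calc ∫⁻ y in closedBall (0 : E3) ρ, ENNReal.ofReal (J F₁ y)
          ≤ ∫⁻ y in closedBall (0 : E3) ρ,
              {y : E3 | E4.ofTimeSpace (τ + F₁ y) y ∈ exterior M a}.indicator
                (fun y ↦ ENNReal.ofReal (24 * (1 + B.bound) ^ 2) * fd F₁ y) y := by
            refine lintegral_mono fun y ↦ ?_
            by_cases hWy : W (E4.ofTimeSpace (τ + F₁ y) y) = 0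
            · have hJ0 : J F₁ y = 0 := by simp only [hJ, hWy, zero_mul]
              rw [hJ0, ENNReal.ofReal_zero]
              exact zero_le
            · have hmem : E4.ofTimeSpace (τ + F₁ y) y ∈ exterior M a := hKU (hWK _ hWy)
              rw [indicator_of_mem (show y ∈ {y : E3 | E4.ofTimeSpace (τ + F₁ y) y ∈ exterior M a}
                from hmem), hfd, ← ENNReal.ofReal_mul (by positivity)]
              refine ENNReal.ofReal_le_ofReal ?_
              have hWQ0 : J F₁ y =
                  W (E4.ofTimeSpace (τ + F₁ y) y) * Q F₁ (E4.ofTimeSpace (τ + F₁ y) y) := by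
                rw [hJWQ F₁]
              rw [hWQ0]
              calc W (E4.ofTimeSpace (τ + F₁ y) y) * Q F₁ (E4.ofTimeSpace (τ + F₁ y) y)
                  ≤ 1 * Q F₁ (E4.ofTimeSpace (τ + F₁ y) y) :=
                    mul_le_mul_of_nonneg_right (hWle _) (hQnn F₁ hslope₁ _)
                _ ≤ 24 * (1 + B.bound) ^ 2 *
                      ∑ μ, fderiv ℝ Φ (E4.ofTimeSpace (τ + F₁ y) y) (E4.basisVector μ) ^ 2 := by
                    rw [one_mul]; exact hQup F₁ hslope₁ _
        _ ≤ ∫⁻ y, {y : E3 | E4.ofTimeSpace (τ + F₁ y) y ∈ exterior M a}.indicator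
              (fun y ↦ ENNReal.ofReal (24 * (1 + B.bound) ^ 2) * fd F₁ y) y :=
            setLIntegral_le_lintegral _ _
        _ = ENNReal.ofReal (24 * (1 + B.bound) ^ 2) * E0 := by
            rw [hE0, ← lintegral_const_mul' _ _ ENNReal.ofReal_ne_top]
            refine lintegral_congr fun y ↦ ?_
            by_cases hy : y ∈ {y : E3 | E4.ofTimeSpace (τ + F₁ y) y ∈ exterior M a}
            · simp only [indicator_of_mem hy]
            · simp only [indicator_of_notMem hy, mul_zero]
    -- (iii) assemble with Grönwall
    have hexp0 : 0 ≤ Real.exp (192 * (1 + B.bound) * D / c * L) := (Real.exp_pos _).le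
    have h6c : 0 ≤ 6 / c := by positivity
    calc ∫⁻ y in S, fd F₂ y
        ≤ ENNReal.ofReal (6 / c * ∫ y in closedBall (0 : E3) ρ, J F₂ y) := h1
      _ ≤ ENNReal.ofReal (6 / c * ((∫ y in closedBall (0 : E3) ρ, J F₁ y) *
            Real.exp (192 * (1 + B.bound) * D / c * L))) :=
          ENNReal.ofReal_le_ofReal (mul_le_mul_of_nonneg_left hgron h6c)
      _ = ENNReal.ofReal (6 / c * Real.exp (192 * (1 + B.bound) * D / c * L)) *
            ENNReal.ofReal (∫ y in closedBall (0 : E3) ρ, J F₁ y) := by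
          rw [← ENNReal.ofReal_mul (by positivity)]
          congr 1; ring
      _ ≤ ENNReal.ofReal (6 / c * Real.exp (192 * (1 + B.bound) * D / c * L)) *
            (ENNReal.ofReal (24 * (1 + B.bound) ^ 2) * E0) := by gcongr
      _ = ENNReal.ofReal (144 * (1 + B.bound) ^ 2 / c *
            Real.exp (192 * (1 + B.bound) * D / c * L)) * E0 := by
          rw [← mul_assoc, ← ENNReal.ofReal_mul (by positivity)]
          congr 2; ring
  -- ### Step 2: exhaust the later leaf by `ε = 1/(n+1) → 0`, `R = n → ∞`
  set S : ℕ → Set E3 := fun n ↦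
    {y : E3 | ‖y‖ ≤ (n : ℝ) ∧
      2 * (1 / ((n : ℝ) + 1)) ≤ horizonFn M a (E4.ofTimeSpace (τ + F₂ y) y)} with hS
  have hhc : Continuous fun y : E3 ↦ horizonFn M a (E4.ofTimeSpace (τ + F₂ y) y) := by
    show Continuous fun y : E3 ↦ (radius a (E4.ofTimeSpace (τ + F₂ y) y) - rPlus M a) *
      Real.exp (-((2 * M)⁻¹ * (τ + F₂ y)))
    exact (((continuous_radius a).comp (hgraph F₂ hF₂.continuous)).sub continuous_const).mul
      (Real.continuous_exp.comp (continuous_const.mul (continuous_const.add hF₂.continuous)).neg)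
  have hSm : ∀ n, MeasurableSet (S n) := fun n ↦
    ((isClosed_le continuous_norm continuous_const).inter
      (isClosed_le continuous_const hhc)).measurableSet
  have hSmono : ∀ {n m : ℕ}, n ≤ m → S n ⊆ S m := by
    intro n m hnm y hy
    have hcast : (n : ℝ) ≤ m := Nat.cast_le.mpr hnm
    refine ⟨hy.1.trans hcast, le_trans ?_ hy.2⟩
    have h1 : (0 : ℝ) < (n : ℝ) + 1 := by positivity
    gcongr
  have hUnion : {y : E3 | E4.ofTimeSpace (τ + F₂ y) y ∈ exterior M a} = ⋃ n, S n := by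
    ext y
    simp only [mem_setOf_eq, mem_iUnion]
    constructor
    · intro hy
      have hr : rPlus M a < radius a (E4.ofTimeSpace (τ + F₂ y) y) := lt_radius_of_mem_region hy
      set h : ℝ := horizonFn M a (E4.ofTimeSpace (τ + F₂ y) y) with hh
      have hpos : 0 < h := mul_pos (sub_pos.mpr hr) (Real.exp_pos _)
      obtain ⟨n, hn⟩ := exists_nat_ge (max ‖y‖ (2 / h))
      refine ⟨n, (le_max_left _ _).trans hn, ?_⟩
      have h2 : 2 / h ≤ n := (le_max_right _ _).trans hn
      have hn1 : (0 : ℝ) < (n : ℝ) + 1 := by positivity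
      rw [div_le_iff₀ hpos] at h2
      rw [← hh, mul_one_div, div_le_iff₀ hn1]
      nlinarith
    · rintro ⟨n, -, hy⟩
      have hpos : 0 < horizonFn M a (E4.ofTimeSpace (τ + F₂ y) y) :=
        lt_of_lt_of_le (by positivity) hy
      rw [mem_exterior, max_eq_left hrp.le]
      exact rPlus_lt_radius_of_horizonFn_pos hpos
  have hind : ∀ y, {y : E3 | E4.ofTimeSpace (τ + F₂ y) y ∈ exterior M a}.indicator (fd F₂) y =
      ⨆ n, (S n).indicator (fd F₂) y := fun y ↦ by
    rw [hUnion]; exact indicator_iUnion_apply rfl _ _ _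
  have hmonof : Monotone fun n ↦ (S n).indicator (fd F₂) := fun n m hnm y ↦
    indicator_le_indicator_of_subset (hSmono hnm) (fun _ ↦ zero_le) y
  calc ∫⁻ y, {y : E3 | E4.ofTimeSpace (τ + F₂ y) y ∈ exterior M a}.indicator (fd F₂) y
      = ∫⁻ y, ⨆ n, (S n).indicator (fd F₂) y := lintegral_congr hind
    _ = ⨆ n, ∫⁻ y, (S n).indicator (fd F₂) y :=
        lintegral_iSup (fun n ↦ (hfm F₂ hF₂.continuous).indicator (hSm n)) hmonof
    _ = ⨆ n, ∫⁻ y in S n, fd F₂ y := by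
        congr with n
        exact lintegral_indicator (hSm n) _
    _ ≤ ENNReal.ofReal (144 * (1 + B.bound) ^ 2 / c *
          Real.exp (192 * (1 + B.bound) * D / c * L)) * E0 :=
        iSup_le fun n ↦ hcore (n : ℝ) (1 / ((n : ℝ) + 1)) n.cast_nonneg (by positivity)

/-! ### Domain of dependence between two graphs: the expanding-hole weight -/

/-- The **hole function** `h_{ρ₁}(x) = ⟨x⃗⟩ − ρ₁ − x⁰`, `⟨x⃗⟩ = (1 + ‖x⃗‖²)^{1/2}`: positive exactly
outside the "expanding hole" `{⟨x⃗⟩ ≤ ρ₁ + x⁰}`, whose boundary moves outward at coordinate speed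
`> 1 ≥` the coordinate speed of light, so that `{h_{ρ₁} > 0}` is a domain of dependence of its
trace on any earlier hypersurface. (`⟨x⃗⟩` instead of `‖x⃗‖` keeps the function smooth.)
[folklore] -/
def holeFn (ρ₁ : ℝ) (x : E4) : ℝ := Real.sqrt (1 + ‖E4.spatial x‖ ^ 2) - ρ₁ - x 0

/-- The hole function is smooth. [folklore] -/
theorem contDiff_holeFn (ρ₁ : ℝ) {n : ℕ∞} : ContDiff ℝ n (holeFn ρ₁) := by
  refine (((contDiff_const.add (E4.spatial.contDiff.norm_sq ℝ)).sqrt fun x ↦ ?_).sub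
    contDiff_const).sub contDiff_apply_zero
  positivity

/-- **The differential of the hole function**: `dh(v) = ⟨x⃗, v⃗⟩/⟨x⃗⟩ − v⁰`. [folklore] -/
theorem fderiv_holeFn_apply (ρ₁ : ℝ) (x v : E4) :
    fderiv ℝ (holeFn ρ₁) x v =
      ⟪E4.spatial x, E4.spatial v⟫ / Real.sqrt (1 + ‖E4.spatial x‖ ^ 2) - v 0 := by
  have hpos : 0 < 1 + ‖E4.spatial x‖ ^ 2 := by positivity
  have h0 : HasFDerivAt (fun y : E4 ↦ y 0) (EuclideanSpace.proj (𝕜 := ℝ) (0 : Fin 4)) x :=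
    (EuclideanSpace.proj (𝕜 := ℝ) (0 : Fin 4)).hasFDerivAt
  have h1 : HasFDerivAt (fun y : E4 ↦ 1 + ‖E4.spatial y‖ ^ 2)
      (2 • (innerSL ℝ (E4.spatial x)).comp E4.spatial) x := by
    have h := (E4.spatial.hasFDerivAt (x := x)).norm_sq.const_add 1
    simpa using h
  have h2 := ((Real.hasDerivAt_sqrt hpos.ne').comp_hasFDerivAt x h1).sub_const ρ₁
  have h := h2.sub h0
  change HasFDerivAt (holeFn ρ₁) _ x at h
  rw [h.fderiv]
  simp only [sub_apply, FunLike.coe_smul, Pi.smul_apply, ContinuousLinearMap.coe_comp,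
    smul_eq_mul, PiLp.proj_apply, nsmul_eq_mul, Nat.cast_ofNat]
  simp only [Pi.mul_apply, Pi.ofNat_apply, Function.comp_apply, innerSL_apply_apply]
  field_simp

/-- `∂₀ h = −1`. [folklore] -/
theorem fderiv_holeFn_basisVector_zero (ρ₁ : ℝ) (x : E4) :
    fderiv ℝ (holeFn ρ₁) x (E4.basisVector 0) = -1 := by
  rw [fderiv_holeFn_apply, E4.spatial_basisVector_zero, inner_zero_right, zero_div]
  simp [E4.basisVector]

/-- `∂_{i+1} h = x⃗_i/⟨x⃗⟩`. [folklore] -/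
theorem fderiv_holeFn_basisVector_succ (ρ₁ : ℝ) (x : E4) (i : Fin 3) :
    fderiv ℝ (holeFn ρ₁) x (E4.basisVector i.succ) =
      E4.spatial x i / Real.sqrt (1 + ‖E4.spatial x‖ ^ 2) := by
  rw [fderiv_holeFn_apply, E4.spatial_basisVector_succ, EuclideanSpace.inner_single_right]
  simp [Fin.succ_ne_zero, E4.basisVector]

/-- `⟨x⃗⟩ ≤ 1 + ‖x⃗‖`. [folklore] -/
theorem sqrt_one_add_norm_sq_le (y : E3) : Real.sqrt (1 + ‖y‖ ^ 2) ≤ 1 + ‖y‖ := by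
  rw [Real.sqrt_le_left (by positivity)]
  nlinarith [norm_nonneg y]

/-- `‖x⃗‖ < ⟨x⃗⟩`. [folklore] -/
theorem lt_sqrt_one_add_norm_sq (y : E3) : ‖y‖ < Real.sqrt (1 + ‖y‖ ^ 2) := by
  rw [Real.lt_sqrt (norm_nonneg y)]
  linarith

/-- **Flux through the expanding hole has a sign.** For every background `B`, every `w`, `ρ₁` and
every point `x`: `∑_μ ∂_μ[χ ∘ h_{ρ₁}](x) T^{μ0}[w](x) ≤ 0`. Indeed `d(χ ∘ h) = −χ'(h) ν` with
`ν = dt* − (x⃗/⟨x⃗⟩)·dy⃗`, `|x⃗/⟨x⃗⟩| < 1`, a covector co-oriented with `dt*` and causal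
(`KerrSchild.Background.coneCovector_causal`); conclude by the dominant energy condition
(`KerrSchild.Background.sum_smul_mul_normalCurrent_nonneg`). Hawking–Ellis 1973, §4.3, Lemma 4.3.1.
[cite: HawkingEllis1973CUP, §4.3 Lemma 4.3.1] -/
theorem holeFactor_flux (B : KerrSchild.Background) (w : E4 → ℝ) (ρ₁ : ℝ) (x : E4) :
    ∑ μ, fderiv ℝ (fun y ↦ Real.smoothTransition (holeFn ρ₁ y)) x (E4.basisVector μ) *
      KerrSchild.normalCurrent B.inverseMetric w x μ ≤ 0 := by
  set s : ℝ := Real.sqrt (1 + ‖E4.spatial x‖ ^ 2) with hs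
  have hspos : 0 < s := Real.sqrt_pos.mpr (by positivity)
  -- the conormal `ν = dt* − (x⃗/⟨x⃗⟩)·dy⃗`
  set ν : Fin 4 → ℝ := ![1, -(E4.spatial x 0 / s), -(E4.spatial x 1 / s), -(E4.spatial x 2 / s)]
    with hν
  have hν0 : ν 0 = 1 := rfl
  have hν1 : ν 1 = -(E4.spatial x 0 / s) := rfl
  have hν2 : ν 2 = -(E4.spatial x 1 / s) := rfl
  have hν3 : ν 3 = -(E4.spatial x 2 / s) := rfl
  have hn : ν 1 ^ 2 + ν 2 ^ 2 + ν 3 ^ 2 ≤ 1 := by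
    rw [hν1, hν2, hν3, neg_sq, neg_sq, neg_sq, div_pow, div_pow, div_pow, ← add_div, ← add_div,
      div_le_one (by positivity), ← E3.norm_sq]
    have : s ^ 2 = 1 + ‖E4.spatial x‖ ^ 2 := by rw [hs, Real.sq_sqrt (by positivity)]
    linarith
  obtain ⟨hcausal, horient⟩ := B.coneCovector_causal x ν hν0 hn
  -- the derivative of the factor
  have hdiff : HasFDerivAt (holeFn ρ₁) (fderiv ℝ (holeFn ρ₁) x) x :=
    ((contDiff_holeFn ρ₁ (n := 1)).differentiable (by simp) x).hasFDerivAt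
  have houter : HasDerivAt Real.smoothTransition (deriv Real.smoothTransition (holeFn ρ₁ x))
      (holeFn ρ₁ x) :=
    ((Real.smoothTransition.contDiffAt (n := 1)).differentiableAt (by simp)).hasDerivAt
  have hd : HasFDerivAt (fun y ↦ Real.smoothTransition (holeFn ρ₁ y))
      (deriv Real.smoothTransition (holeFn ρ₁ x) • fderiv ℝ (holeFn ρ₁) x) x :=
    houter.comp_hasFDerivAt x hdiff
  set k : ℝ := deriv Real.smoothTransition (holeFn ρ₁ x) with hk
  have hk0 : 0 ≤ k := Real.smoothTransition.monotone.deriv_nonneg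
  have e0 : fderiv ℝ (fun y ↦ Real.smoothTransition (holeFn ρ₁ y)) x (E4.basisVector 0) =
      -(k * ν 0) := by
    rw [hd.fderiv, FunLike.coe_smul, Pi.smul_apply, smul_eq_mul, fderiv_holeFn_basisVector_zero,
      hν0, hk]
    ring
  have es : ∀ i : Fin 3, fderiv ℝ (fun y ↦ Real.smoothTransition (holeFn ρ₁ y)) x
      (E4.basisVector i.succ) = -(k * -(E4.spatial x i / s)) := by
    intro i
    rw [hd.fderiv, FunLike.coe_smul, Pi.smul_apply, smul_eq_mul, fderiv_holeFn_basisVector_succ,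
      hk, hs]
    ring
  have e1 : fderiv ℝ (fun y ↦ Real.smoothTransition (holeFn ρ₁ y)) x (E4.basisVector 1) =
      -(k * ν 1) := by rw [hν1]; exact es 0
  have e2 : fderiv ℝ (fun y ↦ Real.smoothTransition (holeFn ρ₁ y)) x (E4.basisVector 2) =
      -(k * ν 2) := by rw [hν2]; exact es 1
  have e3 : fderiv ℝ (fun y ↦ Real.smoothTransition (holeFn ρ₁ y)) x (E4.basisVector 3) =
      -(k * ν 3) := by rw [hν3]; exact es 2
  have hflux := B.sum_smul_mul_normalCurrent_nonneg w x ν hcausal horient hk0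
  rw [Fin.sum_univ_four] at hflux ⊢
  rw [e0, e1, e2, e3]
  linarith

/-- The **far weight** `W = graphWeight · χ(h_{ρ₁})`: the graph weight (backward cone about the
spatial origin, upper time cutoff, horizon factor) localised outside the expanding hole
`{⟨x⃗⟩ ≤ ρ₁ + x⁰}`. [folklore] -/
def farWeight (M a A ε ρ₁ : ℝ) (x : E4) : ℝ :=
  graphWeight M a A ε x * Real.smoothTransition (holeFn ρ₁ x)

/-- `W ≥ 0`. [folklore] -/
theorem farWeight_nonneg (M a A ε ρ₁ : ℝ) (x : E4) : 0 ≤ farWeight M a A ε ρ₁ x :=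
  mul_nonneg (graphWeight_nonneg M a A ε x) (Real.smoothTransition.nonneg _)

/-- `W ≤ 1`. [folklore] -/
theorem farWeight_le_one (M a A ε ρ₁ : ℝ) (x : E4) : farWeight M a A ε ρ₁ x ≤ 1 :=
  mul_le_one₀ (graphWeight_le_one M a A ε x) (Real.smoothTransition.nonneg _)
    (Real.smoothTransition.le_one _)

/-- The far weight is `C¹` (for `r₊ > 0`, `ε > 0`). [folklore] -/
theorem contDiff_farWeight {M a : ℝ} (A : ℝ) {ε : ℝ} (ρ₁ : ℝ) (hr : 0 < rPlus M a) (hε : 0 < ε) :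
    ContDiff ℝ 1 (farWeight M a A ε ρ₁) :=
  (contDiff_graphWeight A hr hε).mul (Real.smoothTransition.contDiff.comp (contDiff_holeFn ρ₁))

/-- Where the far weight is nonzero, the graph weight is nonzero and the point lies outside the
hole: `‖x⃗‖ + 1 > ρ₁ + x⁰`. [folklore] -/
theorem of_farWeight_ne_zero {M a A ε ρ₁ : ℝ} {x : E4} (hx : farWeight M a A ε ρ₁ x ≠ 0) :
    graphWeight M a A ε x ≠ 0 ∧ ρ₁ + x 0 < ‖E4.spatial x‖ + 1 := by
  obtain ⟨h1, h2⟩ := mul_ne_zero_iff.mp hx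
  refine ⟨h1, ?_⟩
  have hpos : 0 < holeFn ρ₁ x := by
    by_contra h
    exact h2 (Real.smoothTransition.zero_of_nonpos (not_lt.mp h))
  have := sqrt_one_add_norm_sq_le (E4.spatial x)
  simp only [holeFn] at hpos
  linarith

/-- **The far weight decreases along the energy flow, everywhere** (subextremal `(M, a)`, `ε > 0`):
`d(W₁ χ_h)·P = χ_h (dW₁·P) + W₁ (dχ_h·P) ≤ 0` by `Kerr.graphWeight_flux` and `Kerr.holeFactor_flux`.
[cite: HawkingEllis1973CUP, §4.3 Lemma 4.3.1] -/
theorem farWeight_flux {M a : ℝ} (hMa : IsSubextremal M a) (w : E4 → ℝ) (A : ℝ) {ε : ℝ}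
    (hε : 0 < ε) (ρ₁ : ℝ) (x : E4) :
    ∑ μ, fderiv ℝ (farWeight M a A ε ρ₁) x (E4.basisVector μ) *
      KerrSchild.normalCurrent
        (surgeryBackground M a (rPlus M a) hMa.pos.le hMa.rPlus_pos).inverseMetric w x μ ≤ 0 := by
  set B := surgeryBackground M a (rPlus M a) hMa.pos.le hMa.rPlus_pos with hB
  set W₁ : E4 → ℝ := graphWeight M a A ε with hW₁
  set W₂ : E4 → ℝ := fun y ↦ Real.smoothTransition (holeFn ρ₁ y) with hW₂
  have hWfun : farWeight M a A ε ρ₁ = fun y ↦ W₁ y * W₂ y := rfl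
  have hW₁d : DifferentiableAt ℝ W₁ x :=
    ((contDiff_graphWeight A hMa.rPlus_pos hε).differentiable one_ne_zero) x
  have hW₂d : DifferentiableAt ℝ W₂ x :=
    ((Real.smoothTransition.contDiff.comp (contDiff_holeFn ρ₁) (n := 1)).differentiable
      one_ne_zero) x
  have h1 : ∑ μ, fderiv ℝ W₁ x (E4.basisVector μ) * KerrSchild.normalCurrent B.inverseMetric w x μ
      ≤ 0 := graphWeight_flux hMa w A hε x
  have h2 : ∑ μ, fderiv ℝ W₂ x (E4.basisVector μ) * KerrSchild.normalCurrent B.inverseMetric w x μ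
      ≤ 0 := holeFactor_flux B w ρ₁ x
  have hW₁0 : 0 ≤ W₁ x := graphWeight_nonneg M a A ε x
  have hW₂0 : 0 ≤ W₂ x := Real.smoothTransition.nonneg _
  rw [hWfun, fderiv_fun_mul hW₁d hW₂d]
  simp only [add_apply, FunLike.coe_smul, Pi.smul_apply, smul_eq_mul]
  have hexp : ∀ μ, (W₁ x * fderiv ℝ W₂ x (E4.basisVector μ) + W₂ x * fderiv ℝ W₁ x (E4.basisVector μ))
      * KerrSchild.normalCurrent B.inverseMetric w x μ =
      W₁ x * (fderiv ℝ W₂ x (E4.basisVector μ) * KerrSchild.normalCurrent B.inverseMetric w x μ) +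
        W₂ x * (fderiv ℝ W₁ x (E4.basisVector μ) *
          KerrSchild.normalCurrent B.inverseMetric w x μ) := fun μ ↦ by ring
  simp only [hexp, Finset.sum_add_distrib, ← Finset.mul_sum]
  have t1 := mul_nonpos_iff.mpr (Or.inl ⟨hW₁0, h2⟩)
  have t2 := mul_nonpos_iff.mpr (Or.inl ⟨hW₂0, h1⟩)
  linarith

/-- The far weight is nonzero at a point `x` with `x⁰ < A`, `‖x⃗‖ < A − x⁰`,
`(r − r₊)e^{−x⁰/(2M)} > ε` and `‖x⃗‖ > ρ₁ + x⁰` (`ε > 0`). [folklore] -/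
theorem farWeight_ne_zero {M a A ε ρ₁ : ℝ} (hε : 0 < ε) {x : E4} (hxA : x 0 < A)
    (hcone : ‖E4.spatial x‖ < A - x 0) (hhor : ε < horizonFn M a x)
    (hhole : ρ₁ + x 0 < ‖E4.spatial x‖) : farWeight M a A ε ρ₁ x ≠ 0 := by
  have h1 : 0 < Real.smoothTransition (A - x 0) := Real.smoothTransition.pos_of_pos (by linarith)
  have h2 : 0 < Real.smoothTransition (coneFn A 0 x) := by
    refine Real.smoothTransition.pos_of_pos ?_
    have hn : 0 ≤ ‖E4.spatial x‖ := norm_nonneg _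
    simp only [coneFn, sub_zero]
    nlinarith
  have h3 : 0 < Real.smoothTransition (horizonFn M a x / ε - 1) := by
    refine Real.smoothTransition.pos_of_pos ?_
    rw [sub_pos, one_lt_div hε]
    exact hhor
  have h4 : 0 < Real.smoothTransition (holeFn ρ₁ x) := by
    refine Real.smoothTransition.pos_of_pos ?_
    have := lt_sqrt_one_add_norm_sq (E4.spatial x)
    simp only [holeFn]
    linarith
  simp only [farWeight, graphWeight]
  positivity

/-- **Domain of dependence between two uniformly spacelike graphs in the Kerr exterior, far
region (coordinate form).** Let `(M, a)` be subextremal, `F₁ ≤ F₂ ≤ F₁ + L` two `C²` height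
functions of slope `≤ 1 − c` (`0 < c ≤ 1`), `Φ` of class `C²` at the exterior points solving the
Kerr wave equation there, and `τ ∈ ℝ`. If the data `(Φ, dΦ)` vanish at the exterior points of the
graph `{x⁰ = τ + F₁(x⃗)}` with `‖x⃗‖ > ρ`, then they vanish at the exterior points of the later graph
`{x⁰ = τ + F₂(x⃗)}` with `‖x⃗‖ > (2 max(ρ, 0) + 1 + F₂(0) − F₁(0))/c`. Proof: the conservation theorem
`KerrSchild.Background.fderiv_eq_zero_of_twoGraphWeight` on the surgered background with the far
weight `Kerr.farWeight` (flux `Kerr.farWeight_flux`), whose support meets the earlier graph only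
where `‖x⃗‖ > ρ`, and integration along the vertical segment between the two graphs.
Hawking–Ellis 1973, §4.3 (the conservation theorem); Dafermos–Rodnianski arXiv:1010.5132, §4.6
(the domain of dependence property used in the reduction to admissible hypersurfaces).
[cite: HawkingEllis1973CUP, §4.3 (Lemma 4.3.1 and the conservation theorem)] -/
theorem vanish_of_graphData_far {M a : ℝ} (hMa : IsSubextremal M a) {F₁ F₂ : E3 → ℝ}
    (hF₁ : ContDiff ℝ 2 F₁) (hF₂ : ContDiff ℝ 2 F₂) {c : ℝ} (hc : 0 < c) (hc1 : c ≤ 1)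
    (hslope₁ : ∀ y, ‖fderiv ℝ F₁ y‖ ≤ 1 - c) (hslope₂ : ∀ y, ‖fderiv ℝ F₂ y‖ ≤ 1 - c)
    (hle : ∀ y, F₁ y ≤ F₂ y) {L : ℝ} (hL : ∀ y, F₂ y - F₁ y ≤ L) {Φ : E4 → ℝ}
    (hΦ2 : ∀ x ∈ (exterior M a : Set E4), ContDiffAt ℝ 2 Φ x)
    (hsol : ∀ x ∈ (exterior M a : Set E4),
      KerrSchild.waveOperator
        (KerrSchild.inverseMetric (fun y ↦ 2 * scalarH M a y) (nullVector a)) Φ x = 0)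
    {τ ρ : ℝ}
    (hdata : ∀ y : E3, ρ < ‖y‖ → E4.ofTimeSpace (τ + F₁ y) y ∈ exterior M a →
      Φ (E4.ofTimeSpace (τ + F₁ y) y) = 0 ∧ fderiv ℝ Φ (E4.ofTimeSpace (τ + F₁ y) y) = 0)
    {y₀ : E3} (hy₀ : (2 * max ρ 0 + 1 + (F₂ 0 - F₁ 0)) / c < ‖y₀‖)
    (hext : E4.ofTimeSpace (τ + F₂ y₀) y₀ ∈ exterior M a) :
    Φ (E4.ofTimeSpace (τ + F₂ y₀) y₀) = 0 ∧ fderiv ℝ Φ (E4.ofTimeSpace (τ + F₂ y₀) y₀) = 0 := by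
  -- ### constants
  have hM : 0 < M := hMa.pos
  have hrp : 0 < rPlus M a := hMa.rPlus_pos
  set B := surgeryBackground M a (rPlus M a) hMa.pos.le hMa.rPlus_pos with hB
  obtain ⟨D, hD0, hD⟩ :=
    exists_bound_fderiv_surgeryBackground_inverseMetric hMa.pos.le a hMa.rPlus_pos
  have hL0 : 0 ≤ L := (sub_nonneg.mpr (hle 0)).trans (hL 0)
  have hF₁d : Differentiable ℝ F₁ := hF₁.differentiable two_ne_zero
  have hF₂d : Differentiable ℝ F₂ := hF₂.differentiable two_ne_zero
  have hF₁lip : ∀ y, F₁ 0 - (1 - c) * ‖y‖ ≤ F₁ y := sub_mul_norm_le_of_norm_fderiv_le hF₁d hslope₁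
  have hF₂ub : ∀ y, F₂ y ≤ F₂ 0 + (1 - c) * ‖y‖ := le_add_mul_norm_of_norm_fderiv_le hF₂d hslope₂
  -- the equation on the surgered background
  have hsolB : ∀ x ∈ (exterior M a : Set E4),
      KerrSchild.waveOperator B.inverseMetric Φ x = 0 := by
    intro x hx
    rw [← KerrSchild.waveOperator_congr_of_eventuallyEq
      (surgeryBackground_inverseMetric_eventuallyEq M a hMa.pos.le hMa.rPlus_pos ⟨x, hx⟩) Φ]
    exact hsol x hx
  -- ### the point, the parameters of the weight
  set p : E4 := E4.ofTimeSpace (τ + F₂ y₀) y₀ with hp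
  have hp0 : p 0 = τ + F₂ y₀ := E4.ofTimeSpace_apply_zero _ _
  have hpsp : E4.spatial p = y₀ := E4.spatial_ofTimeSpace _ _
  set A : ℝ := τ + F₂ y₀ + ‖y₀‖ + 1 with hA
  set ε : ℝ := horizonFn M a p / 2 with hε
  have hhp : 0 < horizonFn M a p :=
    mul_pos (sub_pos.mpr (lt_radius_of_mem_region hext)) (Real.exp_pos _)
  have hε0 : 0 < ε := by positivity
  set ρ₁ : ℝ := 2 * max ρ 0 + 1 - τ - F₁ 0 with hρ₁
  -- `‖y₀‖ > ρ₁ + τ + F₂ y₀` (from the slope bound of `F₂` and the hypothesis on `‖y₀‖`)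
  have hmax : 0 ≤ max ρ 0 := le_max_right _ _
  have hy₀' : 2 * max ρ 0 + 1 + (F₂ 0 - F₁ 0) < c * ‖y₀‖ := by
    rw [div_lt_iff₀ hc] at hy₀; linarith
  have hhole_p : ρ₁ + (τ + F₂ y₀) < ‖y₀‖ := by
    have := hF₂ub y₀
    rw [hρ₁]
    nlinarith [norm_nonneg y₀]
  -- ### the weight and the hypotheses of the conservation theorem
  set W : E4 → ℝ := farWeight M a A ε ρ₁ with hW
  set K : Set E4 := graphWeightSet M a A ε with hK
  have hKc : IsClosed K := isClosed_graphWeightSet M a A ε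
  have hKU : K ⊆ (exterior M a : Set E4) := graphWeightSet_subset_exterior hrp hε0
  have hWK : ∀ z, W z ≠ 0 → z ∈ K := fun z hz ↦
    mem_graphWeightSet_of_ne_zero hε0 (of_farWeight_ne_zero hz).1
  have hW1 : ContDiff ℝ 1 W := contDiff_farWeight A ρ₁ hrp hε0
  have hW0 : ∀ z, 0 ≤ W z := farWeight_nonneg M a A ε ρ₁
  have hsolK : ∀ z ∈ K, KerrSchild.waveOperator B.inverseMetric Φ z = 0 := fun z hz ↦
    hsolB z (hKU hz)
  have hflux : ∀ z ∈ K, τ + F₁ (E4.spatial z) ≤ z 0 → z 0 ≤ τ + F₂ (E4.spatial z) →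
      ∑ μ, fderiv ℝ W z (E4.basisVector μ) * KerrSchild.normalCurrent B.inverseMetric Φ z μ
        ≤ 0 := fun z _ _ _ ↦ farWeight_flux hMa Φ A hε0 ρ₁ z
  have hF₁lip' : ∀ y, (τ + F₁ 0) - (1 - c) * ‖y‖ ≤ τ + F₁ y := fun y ↦ by linarith [hF₁lip y]
  set ρK : ℝ := (A - (τ + F₁ 0)) / c with hρK
  have hρ : ∀ z ∈ K, τ + F₁ (E4.spatial z) ≤ z 0 → z 0 ≤ τ + F₂ (E4.spatial z) →
      E4.spatialNorm z ≤ ρK := fun z hz h1 _ ↦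
    spatialNorm_le_of_mem_graphWeightSet hz hc (F := fun y ↦ τ + F₁ y) hF₁lip' h1
  have hDK : ∀ z ∈ K, ∀ μ α β,
      |fderiv ℝ (fun y ↦ B.inverseMetric y α β) z (E4.basisVector μ)| ≤ D :=
    fun z _ μ α β ↦ hD z μ α β
  -- the data vanish on the initial support of `W`
  have hfar : ∀ z, W z ≠ 0 → τ + F₁ (E4.spatial z) = z 0 → ρ < ‖E4.spatial z‖ := by
    intro z hWz hz0
    obtain ⟨-, hhole⟩ := of_farWeight_ne_zero hWz
    have h1 := hF₁lip (E4.spatial z)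
    have hn := norm_nonneg (E4.spatial z)
    rw [← hz0, hρ₁] at hhole
    have hmax' : ρ ≤ max ρ 0 := le_max_left _ _
    nlinarith
  have hdataW : ∀ z, z 0 = τ + F₁ (E4.spatial z) → W z ≠ 0 → fderiv ℝ Φ z = 0 := by
    intro z hz0 hWz
    have hzU : z ∈ (exterior M a : Set E4) := hKU (hWK z hWz)
    have hzeq : E4.ofTimeSpace (τ + F₁ (E4.spatial z)) (E4.spatial z) = z := by
      rw [← hz0]; exact E4.ofTimeSpace_time_spatial z
    have h := hdata (E4.spatial z) (hfar z hWz hz0.symm) (by rwa [hzeq])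
    rw [hzeq] at h
    exact h.2
  -- ### the vertical segment `s ↦ (τ + F₁ y₀ + s, y₀)`, `0 ≤ s ≤ F₂ y₀ − F₁ y₀`
  set seg : ℝ → E4 := fun u ↦ E4.ofTimeSpace (τ + F₁ y₀ + u) y₀ with hseg
  set g : ℝ := F₂ y₀ - F₁ y₀ with hg
  have hg0 : 0 ≤ g := sub_nonneg.mpr (hle y₀)
  have hseg_p : seg g = p := by simp only [hseg, hp, hg]; ring_nf
  have hWseg : ∀ u ∈ Icc (0 : ℝ) g, W (seg u) ≠ 0 := by
    intro u hu
    have hu0 := hu.1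
    have hug := hu.2
    have hs0 : (seg u) 0 = τ + F₁ y₀ + u := E4.ofTimeSpace_apply_zero _ _
    have hssp : E4.spatial (seg u) = y₀ := E4.spatial_ofTimeSpace _ _
    have hle_p : (seg u) 0 ≤ p 0 := by rw [hs0, hp0, hg] at *; linarith
    refine farWeight_ne_zero hε0 ?_ ?_ ?_ ?_
    · rw [hs0, hA]; nlinarith [norm_nonneg y₀]
    · rw [hssp, hs0, hA]; nlinarith [norm_nonneg y₀]
    · -- the horizon function decreases in time along the segment: `≥` its value at `p` `= 2ε`
      have hr : radius a (seg u) = radius a p := by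
        simp only [hseg, hp, radius_ofTimeSpace]
      have hexp : Real.exp (-((2 * M)⁻¹ * p 0)) ≤ Real.exp (-((2 * M)⁻¹ * (seg u) 0)) := by
        rw [Real.exp_le_exp]
        have : 0 < (2 * M)⁻¹ := by positivity
        nlinarith
      have hpos : 0 < radius a p - rPlus M a := sub_pos.mpr (lt_radius_of_mem_region hext)
      have : horizonFn M a p ≤ horizonFn M a (seg u) := by
        simp only [horizonFn, hr]
        exact mul_le_mul_of_nonneg_left hexp hpos.le
      rw [hε]; linarith
    · rw [hssp, hs0]; nlinarith
  have hseg_mem : ∀ u ∈ Icc (0 : ℝ) g, seg u ∈ (exterior M a : Set E4) := fun u hu ↦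
    hKU (hWK _ (hWseg u hu))
  -- ### the conservation theorem along the segment
  have hdseg : ∀ u ∈ Icc (0 : ℝ) g, fderiv ℝ Φ (seg u) = 0 := by
    intro u hu
    refine B.fderiv_eq_zero_of_twoGraphWeight hKc hKU hΦ2 hW1 hW0 hWK hsolK hF₁ hF₂ hle hc hc1
      hslope₁ hslope₂ hflux hρ (L := L) (fun y _ ↦ hL y) hL0 hD0 hDK hdataW ?_ ?_ (hWseg u hu)
    · simp only [hseg, E4.spatial_ofTimeSpace, E4.ofTimeSpace_apply_zero]; linarith [hu.1]
    · simp only [hseg, E4.spatial_ofTimeSpace, E4.ofTimeSpace_apply_zero, hg] at hu ⊢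
      linarith [hu.2]
  -- ### `Φ(p) = Φ(τ + F₁ y₀, y₀) = 0` by integration along the segment
  have hΦd : ∀ u ∈ Icc (0 : ℝ) g, DifferentiableAt ℝ Φ (seg u) := fun u hu ↦
    (hΦ2 _ (hseg_mem u hu)).differentiableAt two_ne_zero
  have hsegd : ∀ u, HasDerivAt seg (E4.basisVector 0) u := by
    intro u
    have h := (E4.hasDerivAt_ofTimeSpace_left (τ + F₁ y₀ + u) y₀).scomp u
      ((hasDerivAt_id u).const_add (τ + F₁ y₀))
    simpa [hseg, Function.comp_def] using h
  have hconst : ∀ u ∈ Icc (0 : ℝ) g, Φ (seg u) = Φ (seg 0) := by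
    refine constant_of_has_deriv_right_zero (f := fun u ↦ Φ (seg u)) ?_ ?_
    · exact fun u hu ↦ ((hΦd u hu).continuousAt.comp (x := u) (hsegd u).continuousAt
        ).continuousWithinAt
    · intro u hu
      have h := (hΦd u (Ico_subset_Icc_self hu)).hasFDerivAt.comp_hasDerivAt u (hsegd u)
      rw [hdseg u (Ico_subset_Icc_self hu), zero_apply] at h
      exact h.hasDerivWithinAt
  have hseg0 : seg 0 = E4.ofTimeSpace (τ + F₁ y₀) y₀ := by simp only [hseg, add_zero]
  have hy₀ρ : ρ < ‖y₀‖ := by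
    have hmax' : ρ ≤ max ρ 0 := le_max_left _ _
    have hcy : c * ‖y₀‖ ≤ ‖y₀‖ := by nlinarith [norm_nonneg y₀]
    have h01 : 0 ≤ F₂ 0 - F₁ 0 := sub_nonneg.mpr (hle 0)
    linarith
  have h0 : Φ (seg 0) = 0 := by
    rw [hseg0]
    exact (hdata y₀ hy₀ρ (by rw [← hseg0]; exact hseg_mem 0 ⟨le_rfl, hg0⟩)).1
  refine ⟨?_, ?_⟩
  · rw [← hseg_p, hconst g ⟨hg0, le_rfl⟩, h0]
  · rw [← hseg_p]
    exact hdseg g ⟨hg0, le_rfl⟩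

/-! ### Admissible heights differ by bounded functions; `t*`-translation of solutions -/

/-- **Two admissible height functions differ by a bounded function**: `F − G` is continuous with
the finite limit `τ₀(F) − τ₀(G)` at spatial infinity (clause (iii') of `Kerr.IsAdmissibleHeight`),
hence bounded. (Two admissible hypersurfaces of the first kind lie within a slab of each other's
time-translates; Dafermos–Rodnianski arXiv:1010.5132, §4.4, Def. 4.1 (iii).) [folklore] -/
theorem IsAdmissibleHeight.exists_abs_sub_le {M : ℝ} {F G : E3 → ℝ} (hF : IsAdmissibleHeight M F)
    (hG : IsAdmissibleHeight M G) : ∃ L : ℝ, 0 ≤ L ∧ ∀ y : E3, |F y - G y| ≤ L := by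
  obtain ⟨τ₁, h₁⟩ := hF.2.2
  obtain ⟨τ₂, h₂⟩ := hG.2.2
  have ht : Tendsto (fun y ↦ F y - G y) (cocompact E3) (𝓝 (τ₁ - τ₂)) :=
    (h₁.sub h₂).congr fun y ↦ by ring
  have hc : Continuous fun y ↦ F y - G y := hF.contDiff.continuous.sub hG.contDiff.continuous
  obtain ⟨C, hC⟩ := isBounded_iff_forall_norm_le.mp
    (ht.isCompact_insert_range_of_cocompact hc).isBounded
  refine ⟨max C 0, le_max_right _ _, fun y ↦ ?_⟩
  have := hC (F y - G y) (mem_insert_of_mem _ (mem_range_self y))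
  rw [Real.norm_eq_abs] at this
  exact this.trans (le_max_left _ _)

/-- **The `t*`-translate `ψ_s(x) = ψ(x + s ∂_{t*})` of a function on the chart domain `{r > r₀}`.**
Since `∂_{t*}` is Killing for the Kerr–Schild form and the domain is invariant, `ψ_s` solves the
wave equation where `ψ` does (`Kerr.dalembertian_timeTranslate`); this is the map `ψ ↦ ψ ∘ φ_s`
implicit in the formulation "for the foliation `Σ_τ = φ_τ(Σ₀)`" of arXiv:1402.7034, Thm. 3.1, §3.3.
[folklore] -/
def timeTranslate {a r₀ : ℝ} (s : ℝ) (ψ : region a r₀ → ℝ) : region a r₀ → ℝ :=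
  fun x ↦ ψ ⟨(x : E4) + s • E4.basisVector 0, add_smul_basisVector_zero_mem_region x.2 s⟩

/-- Unfolding lemma for `Kerr.timeTranslate`. [folklore] -/
theorem timeTranslate_apply {a r₀ : ℝ} (s : ℝ) (ψ : region a r₀ → ℝ) (x : region a r₀) :
    timeTranslate s ψ x = ψ ⟨(x : E4) + s • E4.basisVector 0, add_smul_basisVector_zero_mem_region x.2 s⟩ := rfl

/-- The translate of the representative represents the translate. [folklore] -/
theorem timeTranslate_rep {a r₀ : ℝ} (s : ℝ) (ψ : region a r₀ → ℝ) (y : region a r₀) :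
    timeTranslate s ψ y =
      (fun z : E4 ↦ Function.extend Subtype.val ψ 0 (z + s • E4.basisVector 0)) y := by
  rw [timeTranslate_apply, extend_rep ψ]

/-- **The translate of a smooth function is smooth.** [folklore] -/
theorem contMDiff_timeTranslate {a r₀ : ℝ} (s : ℝ) {ψ : region a r₀ → ℝ}
    (hψ : ContMDiff 𝓘(ℝ, E4) 𝓘(ℝ, ℝ) ∞ ψ) :
    ContMDiff 𝓘(ℝ, E4) 𝓘(ℝ, ℝ) ∞ (timeTranslate s ψ) := by
  intro y
  rw [OpensChart.contMDiffAt_iff y (timeTranslate s ψ)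
    (fun z : E4 ↦ Function.extend Subtype.val ψ 0 (z + s • E4.basisVector 0)) (timeTranslate_rep s ψ)]
  exact (contDiffAt_extend hψ ⟨(y : E4) + s • E4.basisVector 0, add_smul_basisVector_zero_mem_region y.2 s⟩).comp
    (y : E4) (contDiff_id.add contDiff_const).contDiffAt

/-- **`t*`-translation commutes with the wave operator of the Kerr metric**:
`□_g ψ_s (x) = (□_g ψ)(x + s ∂_{t*})` for smooth `ψ` — the coefficients of `□_g` in the Kerr–Schild
chart do not depend on `t*` (`Kerr.kerrSchild_inverseMetric_add_smul_basisVector_zero`,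
`KerrSchild.waveOperator_comp_add_right`). Kerr–Schild 1965, §2 (`∂_{t*}` is Killing).
[cite: KerrSchild1965, §2] -/
theorem dalembertian_timeTranslate [Facts] [SliceFacts] (M : ℝ) {a r₀ : ℝ} (s : ℝ)
    {ψ : region a r₀ → ℝ} (hψ : ContMDiff 𝓘(ℝ, E4) 𝓘(ℝ, ℝ) ∞ ψ) (x : region a r₀) :
    (smoothMetric M a r₀).toPseudoRiemannianMetric.dalembertian (timeTranslate s ψ) x =
      (smoothMetric M a r₀).toPseudoRiemannianMetric.dalembertian ψ
        ⟨(x : E4) + s • E4.basisVector 0, add_smul_basisVector_zero_mem_region x.2 s⟩ := by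
  set Φ : E4 → ℝ := Function.extend Subtype.val ψ 0 with hΦ
  set v : E4 := s • E4.basisVector 0 with hv
  have hrep : ∀ y, ψ y = Φ y := extend_rep ψ
  have hrep_s : ∀ y, timeTranslate s ψ y = (fun z ↦ Φ (z + v)) y := timeTranslate_rep s ψ
  have hΦ2 : ∀ y : region a r₀, ContDiffAt ℝ 2 Φ y := fun y ↦
    (contDiffAt_extend hψ y).of_le (WithTop.coe_le_coe.mpr le_top)
  set x' : region a r₀ := ⟨(x : E4) + v, add_smul_basisVector_zero_mem_region x.2 s⟩ with hx'
  have hΦs2 : ContDiffAt ℝ 2 (fun z ↦ Φ (z + v)) x :=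
    (hΦ2 x').comp (x : E4) (contDiff_id.add contDiff_const).contDiffAt
  rw [dalembertian_eq_waveOperator M a r₀ hrep_s x hΦs2, dalembertian_eq_waveOperator M a r₀ hrep x'
    (hΦ2 x')]
  exact KerrSchild.waveOperator_comp_add_right
    (fun y μ ν ↦ kerrSchild_inverseMetric_add_smul_basisVector_zero M a y s μ ν) Φ x

/-- The manifold derivative of the translate vanishes where that of `ψ` vanishes at the translated
point. [folklore] -/
theorem mfderiv_timeTranslate_eq_zero {a r₀ : ℝ} (s : ℝ) {ψ : region a r₀ → ℝ}
    (hψ : ContMDiff 𝓘(ℝ, E4) 𝓘(ℝ, ℝ) ∞ ψ) (x : region a r₀)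
    (h : mfderiv 𝓘(ℝ, E4) 𝓘(ℝ, ℝ) ψ ⟨(x : E4) + s • E4.basisVector 0, add_smul_basisVector_zero_mem_region x.2 s⟩
      = 0) :
    mfderiv 𝓘(ℝ, E4) 𝓘(ℝ, ℝ) (timeTranslate s ψ) x = 0 := by
  set Φ : E4 → ℝ := Function.extend Subtype.val ψ 0 with hΦ
  set v : E4 := s • E4.basisVector 0 with hv
  have hrep : ∀ y, ψ y = Φ y := extend_rep ψ
  set x' : region a r₀ := ⟨(x : E4) + v, add_smul_basisVector_zero_mem_region x.2 s⟩ with hx'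
  have hΦd : DifferentiableAt ℝ Φ x' := (contDiffAt_extend hψ x').differentiableAt (by simp)
  have hΦsd : DifferentiableAt ℝ (fun z ↦ Φ (z + v)) x :=
    hΦd.comp (x : E4) (differentiableAt_id.add (differentiableAt_const v))
  rw [OpensChart.mfderiv_eq x (timeTranslate s ψ) (fun z : E4 ↦ Φ (z + v)) (timeTranslate_rep s ψ) hΦsd]
  rw [OpensChart.mfderiv_eq x' ψ Φ hrep hΦd] at h
  set g : E4 → ℝ := Φ with hg
  rw [fderiv_comp_add_right]
  exact h

/-- **The graph energies of the translate are the time-shifted graph energies**: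
`E_F[ψ_s](t) = E_F[ψ](t + s)` (for the restrictions to the exterior chart). [folklore] -/
theorem graphSliceEnergy_timeTranslate {M a r₀ : ℝ} (hr : r₀ ≤ rPlus M a) (s : ℝ)
    (ψ : region a r₀ → ℝ) (F : E3 → ℝ) (t : ℝ) :
    graphSliceEnergy (exterior M a)
        (fun y : exterior M a ↦ timeTranslate s ψ ⟨(y : E4), region_mono a hr y.2⟩) F t =
      graphSliceEnergy (exterior M a)
        (fun y : exterior M a ↦ ψ ⟨(y : E4), region_mono a hr y.2⟩) F (t + s) := by
  set v : E4 := s • E4.basisVector 0 with hv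
  set ψ' : exterior M a → ℝ := fun y ↦ ψ ⟨(y : E4), region_mono a hr y.2⟩ with hψ'
  set ψs' : exterior M a → ℝ := fun y ↦ timeTranslate s ψ ⟨(y : E4), region_mono a hr y.2⟩
    with hψs'
  set Φ' : E4 → ℝ := Function.extend Subtype.val ψ' 0 with hΦ'
  set Φs' : E4 → ℝ := Function.extend Subtype.val ψs' 0 with hΦs'
  have hrep' : ∀ y, ψ' y = Φ' y := extend_rep ψ'
  have hreps' : ∀ y, ψs' y = Φs' y := extend_rep ψs'
  -- near an exterior point, `Φs'` is `z ↦ Φ'(z + v)`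
  have hagree : ∀ z ∈ (exterior M a : Set E4), Φs' =ᶠ[𝓝 z] fun w ↦ Φ' (w + v) := by
    intro z hz
    filter_upwards [(exterior M a).isOpen.mem_nhds hz] with w hw
    have hw' : w + v ∈ (exterior M a : Set E4) := add_smul_basisVector_zero_mem_region hw s
    rw [← hreps' ⟨w, hw⟩, ← hrep' ⟨w + v, hw'⟩]
    rfl
  have hpt : ∀ y : E3, E4.ofTimeSpace (t + F y) y + v = E4.ofTimeSpace (t + s + F y) y := by
    intro y
    rw [hv, ofTimeSpace_add_smul_basisVector_zero]
    ring_nf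
  have hmem : ∀ y : E3, E4.ofTimeSpace (t + F y) y ∈ exterior M a ↔
      E4.ofTimeSpace (t + s + F y) y ∈ exterior M a := by
    intro y
    rw [mem_exterior, mem_exterior, radius_ofTimeSpace a (t + F y), radius_ofTimeSpace a (t + s + F y)]
  unfold graphSliceEnergy
  refine lintegral_congr fun y ↦ ?_
  by_cases hy : E4.ofTimeSpace (t + F y) y ∈ exterior M a
  · have hy' : E4.ofTimeSpace (t + s + F y) y ∈ exterior M a := (hmem y).mp hy
    rw [indicator_of_mem (show y ∈ {y : E3 | E4.ofTimeSpace (t + F y) y ∈ exterior M a} from hy),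
      indicator_of_mem (show y ∈ {y : E3 | E4.ofTimeSpace (t + s + F y) y ∈ exterior M a} from hy'),
      ← sum_sq_fderiv_extend_eq, ← sum_sq_fderiv_extend_eq, (hagree _ hy).fderiv_eq]
    set g : E4 → ℝ := Φ' with hg
    rw [fderiv_comp_add_right, hpt y]
  · have hy' : E4.ofTimeSpace (t + s + F y) y ∉ exterior M a := fun h ↦ hy ((hmem y).mpr h)
    rw [indicator_of_notMem (show y ∉ {y : E3 | E4.ofTimeSpace (t + F y) y ∈ exterior M a} from hy),
      indicator_of_notMem
        (show y ∉ {y : E3 | E4.ofTimeSpace (t + s + F y) y ∈ exterior M a} from hy')]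

/-- A graph shifted by a constant has the shifted graph energies:
`E_{F + L}[ψ](t) = E_F[ψ](t + L)`. [folklore] -/
theorem graphSliceEnergy_height_add_const (U : TopologicalSpace.Opens E4) (ψ : U → ℝ) (F : E3 → ℝ)
    (L t : ℝ) : graphSliceEnergy U ψ (fun y ↦ F y + L) t = graphSliceEnergy U ψ F (t + L) := by
  unfold graphSliceEnergy
  have h : ∀ y : E3, t + (F y + L) = t + L + F y := fun y ↦ by ring
  simp_rw [h]

end Kerr

/-! ### The energy estimate and the domain of dependence between two graphs, manifold form -/

/-- **Energy estimate between two uniformly spacelike graphs, for solutions regular across `𝓗⁺`.**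
For subextremal `(M, a)`, `r₀ ≤ r₊`, and `C²` heights `F₁ ≤ F₂ ≤ F₁ + L` of slope `≤ 1 − c`
(`0 < c ≤ 1`) there is `C < ∞` such that every smooth `ψ : Kerr.region a r₀ → ℝ` solving `□_g ψ = 0`
at the points with `r > r₊` satisfies, for every `τ ∈ ℝ`,
`E[τ + F₂] ≤ C · E[τ + F₁]` (graph energies of the restriction to `{r > r₊}`): the later hypersurface
is controlled by the earlier one (`Kerr.exterior_twoGraphCoordEnergy_le`). Dafermos–Rodnianski
arXiv:1010.5132, §4.6, Prop. 4.6.1 (local energy estimates between admissible hypersurfaces).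
[cite: HawkingEllis1973CUP, §4.3 Lemma 4.3.1; DafermosRodnianski2010KerrSmallA, §4.6 Prop. 4.6.1] -/
theorem kerr_horizonRegular_graphSliceEnergy_le_of_graph_le [Kerr.Facts] [Kerr.SliceFacts]
    {M a r₀ : ℝ} (hMa : Kerr.IsSubextremal M a) (hr : r₀ ≤ Kerr.rPlus M a) {F₁ F₂ : E3 → ℝ}
    (hF₁ : ContDiff ℝ 2 F₁) (hF₂ : ContDiff ℝ 2 F₂) {c : ℝ} (hc : 0 < c) (hc1 : c ≤ 1)
    (hs₁ : ∀ y, ‖fderiv ℝ F₁ y‖ ≤ 1 - c) (hs₂ : ∀ y, ‖fderiv ℝ F₂ y‖ ≤ 1 - c)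
    (hle : ∀ y, F₁ y ≤ F₂ y) {L : ℝ} (hL : ∀ y, F₂ y - F₁ y ≤ L) :
    ∃ C : ℝ≥0∞, C < ⊤ ∧ ∀ ψ : Kerr.region a r₀ → ℝ,
      ContMDiff 𝓘(ℝ, E4) 𝓘(ℝ, ℝ) ∞ ψ →
      (∀ x : Kerr.region a r₀, Kerr.rPlus M a < Kerr.radius a (x : E4) →
        (Kerr.smoothMetric M a r₀).toPseudoRiemannianMetric.dalembertian ψ x = 0) →
      ∀ τ : ℝ,
        graphSliceEnergy (Kerr.exterior M a)
            (fun y : Kerr.exterior M a ↦ ψ ⟨(y : E4), Kerr.region_mono a hr y.2⟩) F₂ τ ≤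
          C * graphSliceEnergy (Kerr.exterior M a)
            (fun y : Kerr.exterior M a ↦ ψ ⟨(y : E4), Kerr.region_mono a hr y.2⟩) F₁ τ := by
  obtain ⟨C₀, C₁, hC₀, hC₁, h⟩ := Kerr.exterior_twoGraphCoordEnergy_le hMa
  refine ⟨ENNReal.ofReal (C₀ / c * Real.exp (C₁ / c * L)), ENNReal.ofReal_lt_top,
    fun ψ hψ hwave τ ↦ ?_⟩
  set ψ' : Kerr.exterior M a → ℝ := fun y ↦ ψ ⟨(y : E4), Kerr.region_mono a hr y.2⟩ with hψ'
  set Φ : E4 → ℝ := Function.extend Subtype.val ψ 0 with hΦ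
  set Φ' : E4 → ℝ := Function.extend Subtype.val ψ' 0 with hΦ'
  have hrep : ∀ y, ψ y = Φ y := extend_rep ψ
  have hrep' : ∀ y, ψ' y = Φ' y := extend_rep ψ'
  have hagree : ∀ z ∈ (Kerr.exterior M a : Set E4), Φ' =ᶠ[𝓝 z] Φ := by
    intro z hz
    filter_upwards [(Kerr.exterior M a).isOpen.mem_nhds hz] with w hw
    rw [← hrep' ⟨w, hw⟩, ← hrep ⟨w, Kerr.region_mono a hr hw⟩]
  have hΦ2 : ∀ z ∈ (Kerr.exterior M a : Set E4), ContDiffAt ℝ 2 Φ z := fun z hz ↦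
    (contDiffAt_extend hψ ⟨z, Kerr.region_mono a hr hz⟩).of_le (WithTop.coe_le_coe.mpr le_top)
  have hsol : ∀ z ∈ (Kerr.exterior M a : Set E4),
      KerrSchild.waveOperator (KerrSchild.inverseMetric (fun y ↦ 2 * Kerr.scalarH M a y)
        (Kerr.nullVector a)) Φ z = 0 := by
    intro z hz
    rw [← Kerr.dalembertian_eq_waveOperator M a r₀ hrep ⟨z, Kerr.region_mono a hr hz⟩ (hΦ2 z hz)]
    exact hwave _ (Kerr.lt_radius_of_mem_region hz)
  have hE : ∀ (F : E3 → ℝ) (t : ℝ), graphSliceEnergy (Kerr.exterior M a) ψ' F t =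
      ∫⁻ y, {y : E3 | E4.ofTimeSpace (t + F y) y ∈ Kerr.exterior M a}.indicator
        (fun y ↦ ENNReal.ofReal
          (∑ μ, fderiv ℝ Φ (E4.ofTimeSpace (t + F y) y) (E4.basisVector μ) ^ 2)) y := by
    intro F t
    unfold graphSliceEnergy
    refine lintegral_congr fun y ↦ ?_
    by_cases hy : y ∈ {y : E3 | E4.ofTimeSpace (t + F y) y ∈ Kerr.exterior M a}
    · rw [indicator_of_mem hy, indicator_of_mem hy, ← Kerr.sum_sq_fderiv_extend_eq,
        (hagree _ hy).fderiv_eq]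
    · rw [indicator_of_notMem hy, indicator_of_notMem hy]
  rw [hE F₂ τ, hE F₁ τ]
  exact h F₁ F₂ c L hF₁ hF₂ hc hc1 hs₁ hs₂ hle hL Φ hΦ2 hsol τ

/-- **Domain of dependence between two graphs, for solutions regular across `𝓗⁺` (manifold
form).** In the setting of `kerr_horizonRegular_graphSliceEnergy_le_of_graph_le`: if the data
`(ψ, dψ)` vanish at the points of `{x⁰ = τ + F₁(x⃗)}` with `‖x⃗‖ > ρ`, then they vanish at the points
of `{x⁰ = τ + F₂(x⃗)}` with `‖x⃗‖ > ρ'` for some `ρ'` (`Kerr.vanish_of_graphData_far`).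
Hawking–Ellis 1973, §4.3 (the conservation theorem).
[cite: HawkingEllis1973CUP, §4.3 (Lemma 4.3.1 and the conservation theorem)] -/
theorem kerr_horizonRegular_vanish_of_graphData [Kerr.Facts] [Kerr.SliceFacts]
    {M a r₀ : ℝ} (hMa : Kerr.IsSubextremal M a) (hr : r₀ ≤ Kerr.rPlus M a) {F₁ F₂ : E3 → ℝ}
    (hF₁ : ContDiff ℝ 2 F₁) (hF₂ : ContDiff ℝ 2 F₂) {c : ℝ} (hc : 0 < c) (hc1 : c ≤ 1)
    (hs₁ : ∀ y, ‖fderiv ℝ F₁ y‖ ≤ 1 - c) (hs₂ : ∀ y, ‖fderiv ℝ F₂ y‖ ≤ 1 - c)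
    (hle : ∀ y, F₁ y ≤ F₂ y) {L : ℝ} (hL : ∀ y, F₂ y - F₁ y ≤ L) {ψ : Kerr.region a r₀ → ℝ}
    (hψ : ContMDiff 𝓘(ℝ, E4) 𝓘(ℝ, ℝ) ∞ ψ)
    (hwave : ∀ x : Kerr.region a r₀, Kerr.rPlus M a < Kerr.radius a (x : E4) →
      (Kerr.smoothMetric M a r₀).toPseudoRiemannianMetric.dalembertian ψ x = 0)
    {τ ρ : ℝ}
    (hdata : ∀ x : Kerr.region a r₀, (x : E4) 0 = τ + F₁ (E4.spatial (x : E4)) →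
      ρ < E4.spatialNorm (x : E4) → ψ x = 0 ∧ mfderiv 𝓘(ℝ, E4) 𝓘(ℝ, ℝ) ψ x = 0) :
    ∃ ρ' : ℝ, ∀ x : Kerr.region a r₀, (x : E4) 0 = τ + F₂ (E4.spatial (x : E4)) →
      ρ' < E4.spatialNorm (x : E4) → ψ x = 0 ∧ mfderiv 𝓘(ℝ, E4) 𝓘(ℝ, ℝ) ψ x = 0 := by
  have hrp : 0 < Kerr.rPlus M a := hMa.rPlus_pos
  set Φ : E4 → ℝ := Function.extend Subtype.val ψ 0 with hΦ
  have hrep : ∀ y, ψ y = Φ y := extend_rep ψ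
  have hΦ2 : ∀ z ∈ (Kerr.exterior M a : Set E4), ContDiffAt ℝ 2 Φ z := fun z hz ↦
    (contDiffAt_extend hψ ⟨z, Kerr.region_mono a hr hz⟩).of_le (WithTop.coe_le_coe.mpr le_top)
  have hΦd : ∀ z ∈ (Kerr.exterior M a : Set E4), DifferentiableAt ℝ Φ z := fun z hz ↦
    (hΦ2 z hz).differentiableAt two_ne_zero
  have hsol : ∀ z ∈ (Kerr.exterior M a : Set E4),
      KerrSchild.waveOperator (KerrSchild.inverseMetric (fun y ↦ 2 * Kerr.scalarH M a y)
        (Kerr.nullVector a)) Φ z = 0 := by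
    intro z hz
    rw [← Kerr.dalembertian_eq_waveOperator M a r₀ hrep ⟨z, Kerr.region_mono a hr hz⟩ (hΦ2 z hz)]
    exact hwave _ (Kerr.lt_radius_of_mem_region hz)
  -- the data of the representative vanish far out on the earlier graph
  have hdataΦ : ∀ y : E3, ρ < ‖y‖ → E4.ofTimeSpace (τ + F₁ y) y ∈ Kerr.exterior M a →
      Φ (E4.ofTimeSpace (τ + F₁ y) y) = 0 ∧ fderiv ℝ Φ (E4.ofTimeSpace (τ + F₁ y) y) = 0 := by
    intro y hy hmem
    set z : Kerr.region a r₀ := ⟨E4.ofTimeSpace (τ + F₁ y) y, Kerr.region_mono a hr hmem⟩ with hz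
    have h := hdata z (by simp [hz, E4.ofTimeSpace_apply_zero, E4.spatial_ofTimeSpace])
      (by simpa [hz, E4.spatialNorm_ofTimeSpace] using hy)
    refine ⟨by rw [← hrep z] at *; exact h.1, ?_⟩
    have h2 := h.2
    rwa [OpensChart.mfderiv_eq z ψ Φ hrep (hΦd _ hmem)] at h2
  -- points far out are exterior points
  set ρ' : ℝ := max ((2 * max ρ 0 + 1 + (F₂ 0 - F₁ 0)) / c) (Kerr.rPlus M a + |a|) with hρ'
  refine ⟨ρ', fun x hx0 hxρ ↦ ?_⟩
  have hx1 : (2 * max ρ 0 + 1 + (F₂ 0 - F₁ 0)) / c < E4.spatialNorm (x : E4) :=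
    lt_of_le_of_lt (le_max_left _ _) hxρ
  have hx2 : Kerr.rPlus M a + |a| < E4.spatialNorm (x : E4) := lt_of_le_of_lt (le_max_right _ _) hxρ
  have hext : (x : E4) ∈ Kerr.exterior M a := by
    rw [Kerr.mem_exterior, max_eq_left hrp.le]
    have h1 := Kerr.spatialNorm_sq_sub_sq_le_radius_sq a (x : E4)
    have hr0 := Kerr.radius_nonneg a (x : E4)
    have ha := abs_nonneg a
    have hsq : a ^ 2 = |a| ^ 2 := (sq_abs a).symm
    nlinarith
  have hxeq : E4.ofTimeSpace (τ + F₂ (E4.spatial (x : E4))) (E4.spatial (x : E4)) = (x : E4) := by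
    rw [← hx0]; exact E4.ofTimeSpace_time_spatial _
  have hnorm : E4.spatialNorm (x : E4) = ‖E4.spatial (x : E4)‖ := rfl
  have h := Kerr.vanish_of_graphData_far hMa hF₁ hF₂ hc hc1 hs₁ hs₂ hle hL hΦ2 hsol hdataΦ
    (y₀ := E4.spatial (x : E4)) (by rwa [← hnorm]) (by rwa [hxeq])
  rw [hxeq] at h
  refine ⟨by rw [hrep]; exact h.1, ?_⟩
  rw [OpensChart.mfderiv_eq x ψ Φ hrep (hΦd _ hext)]
  exact h.2

/-! ### The reduction of the named fact to a single admissible foliation -/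

/-- **Reduction of `DafermosRodnianskiShlapentokhRothman2016_energyBoundedness_horizonRegular` to
one admissible foliation** (the §3.3 reduction of arXiv:1402.7034, i.e. Dafermos–Rodnianski
arXiv:1010.5132, Prop. 4.6.1, for the Kerr–Schild-admissible graphs of `Kerr.IsAdmissibleHeight`).
Suppose that for every subextremal `(M, a)` and `r₋ < r₀ < r₊` there is ONE admissible height
function `F₀` through whose foliation `{t* = τ + F₀}` the uniform boundedness (23) holds for the
horizon-regular class. Then it holds through the foliation of EVERY admissible `F`, with a constant
depending on `F`: writing `|F − F₀| ≤ L` (`Kerr.IsAdmissibleHeight.exists_abs_sub_le`), for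
`τ ≥ 2L` one has `E_F(τ) ≤ C·E_{F₀}(τ − L)` (`kerr_horizonRegular_graphSliceEnergy_le_of_graph_le`,
graph `τ + F` later than graph `τ − L + F₀`), `E_{F₀}(τ − L) = E_{F₀}[ψ_L](τ − 2L) ≤ C₀ E_{F₀}[ψ_L](0)
= C₀ E_{F₀}(L)` (the hypothesis for the translate `ψ_L = ψ ∘ φ_L`, `Kerr.timeTranslate`, which is
again a smooth solution, `Kerr.dalembertian_timeTranslate`, whose data on `{t* = F₀}` are those of
`ψ` on the later graph `{t* = L + F₀}` and hence compactly supported by the domain of dependence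
property `kerr_horizonRegular_vanish_of_graphData`), and `E_{F₀}(L) ≤ C·E_F(0)` (graph `L + F₀`
later than graph `F`); for `0 ≤ τ ≤ 2L` the finite-in-time estimate
`kerr_horizonRegular_graphSliceEnergy_finiteTime` applies. Thus the named fact — Theorem 3.1 (23)
of arXiv:1402.7034 in its §3.3 form for all admissible hypersurfaces — is equivalent to its
instance for any single admissible foliation; what is not proved in this library is that instance
(the Annals theorem itself).
[cite: DafermosRodnianskiShlapentokhrothman2014, Thm. 3.1 (23), §3.3;
DafermosRodnianski2010KerrSmallA, §4.6 Prop. 4.6.1] -/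
theorem DafermosRodnianskiShlapentokhRothman2016_energyBoundedness_horizonRegular_of_exists
    (h : ∀ [Kerr.Facts] [Kerr.SliceFacts] (M a r₀ : ℝ) (hr : r₀ < Kerr.rPlus M a),
      Kerr.IsSubextremal M a → Kerr.rMinus M a < r₀ →
      ∃ F₀ : E3 → ℝ, Kerr.IsAdmissibleHeight M F₀ ∧
        ∃ C : ℝ≥0∞, C < ⊤ ∧ ∀ ψ : Kerr.region a r₀ → ℝ,
          ContMDiff 𝓘(ℝ, E4) 𝓘(ℝ, ℝ) ∞ ψ →
          (∀ x : Kerr.region a r₀, Kerr.rPlus M a < Kerr.radius a (x : E4) →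
            (Kerr.smoothMetric M a r₀).toPseudoRiemannianMetric.dalembertian ψ x = 0) →
          (∃ ρ : ℝ, ∀ x : Kerr.region a r₀, (x : E4) 0 = F₀ (E4.spatial (x : E4)) →
              ρ < E4.spatialNorm (x : E4) → ψ x = 0 ∧ mfderiv 𝓘(ℝ, E4) 𝓘(ℝ, ℝ) ψ x = 0) →
          ∀ τ : ℝ, 0 ≤ τ →
            graphSliceEnergy (Kerr.exterior M a)
                (fun y : Kerr.exterior M a ↦ ψ ⟨(y : E4), Kerr.region_mono a hr.le y.2⟩) F₀ τ ≤
              C * graphSliceEnergy (Kerr.exterior M a)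
                (fun y : Kerr.exterior M a ↦ ψ ⟨(y : E4), Kerr.region_mono a hr.le y.2⟩) F₀ 0) :
    DafermosRodnianskiShlapentokhRothman2016_energyBoundedness_horizonRegular := by
  intro _ _ M a r₀ hr hMa hrm F hF
  obtain ⟨F₀, hF₀, C₀, hC₀, h₀⟩ := h M a r₀ hr hMa hrm
  -- ### slopes and regularity
  obtain ⟨c₁, hc₁, hc₁1, hs₁⟩ := hF.exists_slope_le'
  obtain ⟨c₂, hc₂, -, hs₂⟩ := hF₀.exists_slope_le'
  have hc : 0 < min c₁ c₂ := lt_min hc₁ hc₂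
  have hc1 : min c₁ c₂ ≤ 1 := (min_le_left _ _).trans hc₁1
  have hsF : ∀ y, ‖fderiv ℝ F y‖ ≤ 1 - min c₁ c₂ := fun y ↦
    (hs₁ y).trans (by linarith [min_le_left c₁ c₂])
  have hsF₀ : ∀ y, ‖fderiv ℝ F₀ y‖ ≤ 1 - min c₁ c₂ := fun y ↦
    (hs₂ y).trans (by linarith [min_le_right c₁ c₂])
  have hF2 : ContDiff ℝ 2 F := hF.contDiff.of_le (WithTop.coe_le_coe.mpr le_top)
  have hF₀2 : ContDiff ℝ 2 F₀ := hF₀.contDiff.of_le (WithTop.coe_le_coe.mpr le_top)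
  -- ### the two heights differ by at most `L`; the shifted heights `F₀ ± L`
  obtain ⟨L, hL0, hL⟩ := hF.exists_abs_sub_le hF₀
  have hL' : ∀ y, F y - F₀ y ≤ L ∧ F₀ y - F y ≤ L := fun y ↦ abs_sub_le_iff.mp (hL y)
  set Fp : E3 → ℝ := fun y ↦ F₀ y + L with hFp
  set Fm : E3 → ℝ := fun y ↦ F₀ y + -L with hFm
  have hFp2 : ContDiff ℝ 2 Fp := hF₀2.add contDiff_const
  have hFm2 : ContDiff ℝ 2 Fm := hF₀2.add contDiff_const
  have hsFp : ∀ y, ‖fderiv ℝ Fp y‖ ≤ 1 - min c₁ c₂ := fun y ↦ by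
    rw [hFp, fderiv_add_const]; exact hsF₀ y
  have hsFm : ∀ y, ‖fderiv ℝ Fm y‖ ≤ 1 - min c₁ c₂ := fun y ↦ by
    rw [hFm, fderiv_add_const]; exact hsF₀ y
  have hle1 : ∀ y, F y ≤ Fp y := fun y ↦ by simp only [hFp]; linarith [(hL' y).1]
  have hL1 : ∀ y, Fp y - F y ≤ 2 * L := fun y ↦ by simp only [hFp]; linarith [(hL' y).2]
  have hle2 : ∀ y, Fm y ≤ F y := fun y ↦ by simp only [hFm]; linarith [(hL' y).2]
  have hL2 : ∀ y, F y - Fm y ≤ 2 * L := fun y ↦ by simp only [hFm]; linarith [(hL' y).1]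
  -- ### the three constants
  obtain ⟨CA, hCA, hA⟩ := kerr_horizonRegular_graphSliceEnergy_le_of_graph_le hMa hr.le hF2 hFp2
    hc hc1 hsF hsFp hle1 hL1
  obtain ⟨CB, hCB, hB⟩ := kerr_horizonRegular_graphSliceEnergy_le_of_graph_le hMa hr.le hFm2 hF2
    hc hc1 hsFm hsF hle2 hL2
  obtain ⟨Cf, hCf, hfin⟩ := kerr_horizonRegular_graphSliceEnergy_finiteTime hMa hr.le hF (2 * L)
  refine ⟨max Cf (CB * C₀ * CA),
    max_lt hCf (ENNReal.mul_lt_top (ENNReal.mul_lt_top hCB hC₀) hCA), fun ψ hψ hwave hsupp τ hτ ↦ ?_⟩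
  rcases le_or_gt τ (2 * L) with hτL | hτL
  · exact (hfin ψ hψ hwave τ hτ hτL).trans (mul_le_mul_left (le_max_left _ _) _)
  -- ### `τ > 2L`: through the reference foliation and the translate `ψ_L`
  -- (1) the translate is a smooth solution with compactly supported data on `{t* = F₀}`
  have hψL : ContMDiff 𝓘(ℝ, E4) 𝓘(ℝ, ℝ) ∞ (Kerr.timeTranslate L ψ) :=
    Kerr.contMDiff_timeTranslate L hψ
  have hwaveL : ∀ x : Kerr.region a r₀, Kerr.rPlus M a < Kerr.radius a (x : E4) →
      (Kerr.smoothMetric M a r₀).toPseudoRiemannianMetric.dalembertian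
        (Kerr.timeTranslate L ψ) x = 0 := by
    intro x hx
    rw [Kerr.dalembertian_timeTranslate M L hψ x]
    refine hwave _ ?_
    show Kerr.rPlus M a < Kerr.radius a ((x : E4) + L • E4.basisVector 0)
    rwa [Kerr.radius_add_time_smul_basisVector]
  have hsuppL : ∃ ρ' : ℝ, ∀ x : Kerr.region a r₀, (x : E4) 0 = F₀ (E4.spatial (x : E4)) →
      ρ' < E4.spatialNorm (x : E4) →
        Kerr.timeTranslate L ψ x = 0 ∧ mfderiv 𝓘(ℝ, E4) 𝓘(ℝ, ℝ) (Kerr.timeTranslate L ψ) x = 0 := by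
    obtain ⟨ρ, hρ⟩ := hsupp
    obtain ⟨ρ', hρ'⟩ := kerr_horizonRegular_vanish_of_graphData hMa hr.le hF2 hFp2 hc hc1 hsF hsFp
      hle1 hL1 hψ hwave (τ := 0) (ρ := ρ) (fun x hx0 hxρ ↦ hρ x (by rw [hx0, zero_add]) hxρ)
    refine ⟨ρ', fun x hx0 hxρ ↦ ?_⟩
    set x' : Kerr.region a r₀ := ⟨(x : E4) + L • E4.basisVector 0, Kerr.add_smul_basisVector_zero_mem_region x.2 L⟩
      with hx'
    have hxeq : E4.ofTimeSpace ((x : E4) 0 + L) (E4.spatial (x : E4)) = (x' : E4) := by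
      rw [hx', ← Kerr.ofTimeSpace_add_smul_basisVector_zero]
      exact congrArg (· + L • E4.basisVector 0) (E4.ofTimeSpace_time_spatial _)
    have hx'0 : (x' : E4) 0 = 0 + Fp (E4.spatial (x' : E4)) := by
      rw [← hxeq, E4.ofTimeSpace_apply_zero, E4.spatial_ofTimeSpace, hx0, hFp]
      ring
    have hx'ρ : ρ' < E4.spatialNorm (x' : E4) := by
      rw [← hxeq, E4.spatialNorm_ofTimeSpace]
      exact hxρ
    have h' := hρ' x' hx'0 hx'ρ
    exact ⟨h'.1, Kerr.mfderiv_timeTranslate_eq_zero L hψ x h'.2⟩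
  -- (2) the hypothesis for the translate, transported back to `ψ`
  have h2 := h₀ (Kerr.timeTranslate L ψ) hψL hwaveL hsuppL (τ - 2 * L) (by linarith)
  rw [Kerr.graphSliceEnergy_timeTranslate hr.le L ψ F₀ (τ - 2 * L),
    Kerr.graphSliceEnergy_timeTranslate hr.le L ψ F₀ 0] at h2
  -- (3) the two local estimates
  have h1 := hB ψ hψ hwave τ
  have h3 := hA ψ hψ hwave 0
  have hEm : graphSliceEnergy (Kerr.exterior M a)
      (fun y : Kerr.exterior M a ↦ ψ ⟨(y : E4), Kerr.region_mono a hr.le y.2⟩) Fm τ =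
      graphSliceEnergy (Kerr.exterior M a)
        (fun y : Kerr.exterior M a ↦ ψ ⟨(y : E4), Kerr.region_mono a hr.le y.2⟩) F₀ (τ - 2 * L + L) := by
    rw [hFm, Kerr.graphSliceEnergy_height_add_const]
    congr 1
    ring
  have hEp : graphSliceEnergy (Kerr.exterior M a)
      (fun y : Kerr.exterior M a ↦ ψ ⟨(y : E4), Kerr.region_mono a hr.le y.2⟩) Fp 0 =
      graphSliceEnergy (Kerr.exterior M a)
        (fun y : Kerr.exterior M a ↦ ψ ⟨(y : E4), Kerr.region_mono a hr.le y.2⟩) F₀ (0 + L) := by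
    rw [hFp, Kerr.graphSliceEnergy_height_add_const]
  rw [hEm] at h1
  rw [hEp] at h3
  -- (4) assemble
  calc graphSliceEnergy (Kerr.exterior M a)
        (fun y : Kerr.exterior M a ↦ ψ ⟨(y : E4), Kerr.region_mono a hr.le y.2⟩) F τ
      ≤ CB * (C₀ * (CA * graphSliceEnergy (Kerr.exterior M a)
          (fun y : Kerr.exterior M a ↦ ψ ⟨(y : E4), Kerr.region_mono a hr.le y.2⟩) F 0)) :=
        h1.trans (mul_le_mul_right (h2.trans (mul_le_mul_right h3 _)) _)
    _ = CB * C₀ * CA * graphSliceEnergy (Kerr.exterior M a)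
          (fun y : Kerr.exterior M a ↦ ψ ⟨(y : E4), Kerr.region_mono a hr.le y.2⟩) F 0 := by ring
    _ ≤ max Cf (CB * C₀ * CA) * graphSliceEnergy (Kerr.exterior M a)
          (fun y : Kerr.exterior M a ↦ ψ ⟨(y : E4), Kerr.region_mono a hr.le y.2⟩) F 0 :=
        mul_le_mul_left (le_max_right _ _) _

end Literature.Geometry.Lorentzian

end
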